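import Literature.Probability.RandomPlanarGeometry.SAWPatternDensity
import Literature.Probability.RandomPlanarGeometry.SAWKestenRatioExplicit
import Literature.Probability.RandomPlanarGeometry.BDGS2012CountBoundsProofs
import Mathlib.Algebra.Order.Chebyshev
import HarnessLib

/-!
# Kesten's ratio inequality from hairpins (robust swap pair) — lane pcv-sawmu item KR-1 / KR-3

Madras–Slade prove Theorem 7.3.2 (a) (`φ_N φ_{N+2} ≥ φ_N² − D/N`, `φ_N = c_{N+2}/c_N`) with Kesten's pair of
cube patterns `(U, Q)`, `(V, Q)` and the Pattern Theorem for `(V, Q)`.  Here the pattern pair is replaced by the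
bare swap pair "U-occurrence `(k, a)` (the two sites `ω(k)+a`, `ω(k+1)+a` beside the `k`-th step are free) ↔
tight hairpin (U-turn)": inserting the two sites is always a self-avoiding walk with a hairpin at `k`, contracting
any hairpin is always legal, and the pairs are counted in two ways EXACTLY; the occurrence bookkeeping is no longer
exact but changes by bounded amounts (`J − 2 ≤ J' ≤ J + 5`, `I' ≥ I − 10(d+2)`), which only changes Kesten's
constant.  The density input is then the hairpin density (lane item HP: explicit on `ℤ²`), and the output is
Kesten's inequality (7.3.3) with an explicit constant, the hypothesis `hK` of `KestenRate.upper_dev/lower_dev`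
(`SAWKestenRatioExplicit.lean`). Idea and statement shapes: lane seat a-idea-2 (ROUTES §25).
-/

noncomputable section

open Filter Topology Literature.Probability.LatticeModels Literature.Probability.Percolation SimpleGraph
open scoped BigOperators

namespace Literature.Probability.RandomPlanarGeometry.SAW.Zd

namespace KestenHairpin

variable {d : ℕ}

/-! ### Unit vectors -/

/-- The `2(d+2)` unit vectors of `ℤ^{d+2}`. [folklore] -/
private def units : Finset (Site (d + 2)) :=
  Finset.univ.biUnion fun i : Fin (d + 2) => {Pi.single i 1, -Pi.single i 1}

/-- Membership in `units`. [folklore] -/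
private theorem mem_units {a : Site (d + 2)} : a ∈ units ↔ ∃ i : Fin (d + 2), a = Pi.single i 1 ∨ a = -Pi.single i 1 := by
  simp [units]

/-- Adjacency is "difference is a unit vector". [folklore] -/
private theorem adj_iff_sub_mem_units {x y : Site (d + 2)} : (zdGraph (d + 2)).Adj x y ↔ y - x ∈ units := by
  rw [zdGraph_adj_iff_sub, mem_units]
  refine exists_congr fun i => or_congr Iff.rfl ?_
  constructor
  · intro h; rw [← h, neg_sub]
  · intro h; rw [← neg_sub, h, neg_neg]

/-- `x ~ x + a` for a unit vector `a`. [folklore] -/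
private theorem adj_add_of_mem_units {a : Site (d + 2)} (ha : a ∈ units) (x : Site (d + 2)) :
    (zdGraph (d + 2)).Adj x (x + a) := by
  rw [adj_iff_sub_mem_units, add_sub_cancel_left]; exact ha

/-- There are at most `2(d+2)` unit vectors. [folklore] -/
private theorem card_units_le : (units : Finset (Site (d + 2))).card ≤ 2 * (d + 2) := by
  unfold units
  calc (Finset.univ.biUnion fun i : Fin (d + 2) => ({Pi.single i 1, -Pi.single i 1} : Finset (Site (d + 2)))).card
      ≤ ∑ i : Fin (d + 2), ({Pi.single i 1, -Pi.single i 1} : Finset (Site (d + 2))).card :=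
        Finset.card_biUnion_le
    _ ≤ ∑ _i : Fin (d + 2), 2 := Finset.sum_le_sum fun i _ => Finset.card_le_two
    _ = 2 * (d + 2) := by simp [mul_comm]

/-! ### Hairpins and U-occurrences -/

/-- A tight hairpin (U-turn) at step `j` of the `N`-step walk `ω`: "third step = minus the first",
`ω(j+3) − ω(j+2) = ω(j) − ω(j+1)`, `j + 3 ≤ N` (lane item HP, seat a-idea-2's `hairpinAt`, verbatim).
[cite: MadrasSlade1993, Definition 7.1.1 (a pattern occurring at the `j`-th step of `ω`; here the three-step U-turn `(a, b, −a)`)] -/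
def hairpinAt (N : ℕ) (ω : ℕ → Site (d + 2)) (j : ℕ) : Prop :=
  j + 3 ≤ N ∧ ω (j + 3) - ω (j + 2) = ω j - ω (j + 1)

/-- A U-occurrence `(k, a)` of the `n`-step walk `ω`: `k < n`, `a` a unit vector, and the two sites
`ω(k) + a`, `ω(k+1) + a` beside the `k`-th step are off the walk. [cite: MadrasSlade1993, Theorem 7.3.2 (proof: the occurrences counted by `I(ω)`; here the bare two-site swap)] -/
def IsUocc (n : ℕ) (ω : ℕ → Site (d + 2)) (k : ℕ) (a : Site (d + 2)) : Prop :=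
  k < n ∧ a ∈ units ∧ (∀ i ≤ n, ω i ≠ ω k + a) ∧ (∀ i ≤ n, ω i ≠ ω (k + 1) + a)

open Classical in
/-- The U-occurrences of `ω`. [folklore] -/
private def uocc (n : ℕ) (ω : ℕ → Site (d + 2)) : Finset (ℕ × Site (d + 2)) :=
  (Finset.range n ×ˢ units).filter fun p => IsUocc n ω p.1 p.2

/-- `I(ω)`, the number of U-occurrences. [cite: MadrasSlade1993, Theorem 7.3.2 (proof), `I(ω)`] -/
def ucount (n : ℕ) (ω : ℕ → Site (d + 2)) : ℕ := (uocc n ω).card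

/-- `J(ω)`, the number of hairpins. [cite: MadrasSlade1993, Theorem 7.3.2 (proof), `J(ω)` (here: the number of tight U-turns)] -/
def hcount (n : ℕ) (ω : ℕ → Site (d + 2)) : ℕ := occ hairpinAt n ω

open Classical in
/-- Membership in `uocc`. [folklore] -/
private theorem mem_uocc {n : ℕ} {ω : ℕ → Site (d + 2)} {p : ℕ × Site (d + 2)} :
    p ∈ uocc n ω ↔ IsUocc n ω p.1 p.2 := by
  unfold uocc
  rw [Finset.mem_filter, Finset.mem_product, Finset.mem_range]
  exact ⟨fun h => h.2, fun h => ⟨⟨h.1, h.2.1⟩, h⟩⟩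

/-- `I(ω) ≤ 2(d+2) n`. [folklore] -/
private theorem ucount_le (n : ℕ) (ω : ℕ → Site (d + 2)) : ucount n ω ≤ 2 * (d + 2) * n := by
  classical
  unfold ucount uocc
  calc ((Finset.range n ×ˢ units).filter fun p => IsUocc n ω p.1 p.2).card
      ≤ (Finset.range n ×ˢ (units : Finset (Site (d + 2)))).card := Finset.card_filter_le _ _
    _ = n * (units : Finset (Site (d + 2))).card := by rw [Finset.card_product, Finset.card_range]
    _ ≤ n * (2 * (d + 2)) := Nat.mul_le_mul_left _ card_units_le
    _ = 2 * (d + 2) * n := by ring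

open Classical in
/-- `J(ω) ≤ n + 1`. [folklore] -/
private theorem hcount_le (n : ℕ) (ω : ℕ → Site (d + 2)) : hcount n ω ≤ n + 1 := by
  unfold hcount occ
  exact (Finset.card_filter_le _ _).trans (by rw [Finset.card_range])

/-! ### The swap and the contraction -/

/-- Swap at the U-occurrence `(k, a)`: insert the two sites `ω(k)+a`, `ω(k+1)+a` after time `k`. [folklore] -/
private def swap (k : ℕ) (a : Site (d + 2)) (ω : ℕ → Site (d + 2)) : ℕ → Site (d + 2) :=
  fun t => if t ≤ k then ω t else if t = k + 1 then ω k + a else if t = k + 2 then ω (k + 1) + a else ω (t - 2)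

/-- Contraction of the hairpin at `j`: delete the two sites `ω(j+1)`, `ω(j+2)`. [folklore] -/
private def contract (j : ℕ) (ω : ℕ → Site (d + 2)) : ℕ → Site (d + 2) :=
  fun t => if t ≤ j then ω t else ω (t + 2)

section SwapLemmas

variable {n k j : ℕ} {a : Site (d + 2)} {ω : ℕ → Site (d + 2)}

/-- (bookkeeping) [folklore] -/
@[simp] private theorem swap_of_le {t : ℕ} (ht : t ≤ k) : swap k a ω t = ω t := by simp [swap, ht]
/-- (bookkeeping) [folklore] -/
@[simp] private theorem swap_k1 : swap k a ω (k + 1) = ω k + a := by simp [swap]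
/-- (bookkeeping) [folklore] -/
@[simp] private theorem swap_k2 : swap k a ω (k + 2) = ω (k + 1) + a := by
  simp [swap, show ¬ (k + 2 ≤ k) by omega]
/-- (bookkeeping) [folklore] -/
private theorem swap_of_ge {t : ℕ} (ht : k + 3 ≤ t) : swap k a ω t = ω (t - 2) := by
  simp [swap, show ¬ (t ≤ k) by omega, show t ≠ k + 1 by omega, show t ≠ k + 2 by omega]
/-- (bookkeeping) [folklore] -/
@[simp] private theorem contract_of_le {t : ℕ} (ht : t ≤ j) : contract j ω t = ω t := by simp [contract, ht]
/-- (bookkeeping) [folklore] -/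
private theorem contract_of_gt {t : ℕ} (ht : j < t) : contract j ω t = ω (t + 2) := by
  simp [contract, show ¬ (t ≤ j) by omega]

/-- Contracting the swap gives back the walk. [folklore] -/
private theorem contract_swap (k : ℕ) (a : Site (d + 2)) (ω : ℕ → Site (d + 2)) :
    contract k (swap k a ω) = ω := by
  funext t
  rcases le_or_gt t k with h | h
  · rw [contract_of_le h, swap_of_le h]
  · rw [contract_of_gt h, swap_of_ge (by omega)]; rfl

/-- The recovered unit vector. [folklore] -/
private theorem swap_k1_sub (k : ℕ) (a : Site (d + 2)) (ω : ℕ → Site (d + 2)) :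
    swap k a ω (k + 1) - swap k a ω k = a := by
  rw [swap_k1, swap_of_le le_rfl, add_sub_cancel_left]

/-- Swapping back the contraction of a hairpin gives back the walk. [folklore] -/
private theorem swap_contract (hj : hairpinAt n ω j) :
    swap j (ω (j + 1) - ω j) (contract j ω) = ω := by
  funext t
  rcases le_or_gt t j with h | h
  · rw [swap_of_le h, contract_of_le h]
  · rcases lt_trichotomy t (j + 2) with h2 | rfl | h2
    · obtain rfl : t = j + 1 := by omega
      rw [swap_k1, contract_of_le le_rfl]; abel
    · rw [swap_k2, contract_of_gt (Nat.lt_succ_self j)]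
      have e := hj.2
      rw [show j + 1 + 2 = j + 3 by ring]
      rw [sub_eq_iff_eq_add] at e
      rw [e]; abel
    · rw [swap_of_ge (by omega), contract_of_gt (by omega)]
      congr 1; omega

/-- The swap has a hairpin at `k`. [folklore] -/
private theorem hairpinAt_swap (hk : k < n) : hairpinAt (n + 2) (swap k a ω) k := by
  refine ⟨by omega, ?_⟩
  rw [swap_of_ge le_rfl, show k + 3 - 2 = k + 1 by omega, swap_k2, swap_of_le le_rfl, swap_k1]
  abel

/-- **The swap of a U-occurrence is a self-avoiding walk.** [folklore] -/
private theorem swap_mem_saws (hω : ω ∈ saws (d + 2) n) (hu : IsUocc n ω k a) :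
    swap k a ω ∈ saws (d + 2) (n + 2) := by
  obtain ⟨h0, he, hadj, hinj⟩ := mem_saws.1 hω
  obtain ⟨hk, ha, hp, hq⟩ := hu
  rw [mem_saws]
  refine ⟨by rw [swap_of_le (Nat.zero_le k), h0], fun i hi => ?_, fun i hi => ?_, ?_⟩
  · rw [swap_of_ge (by omega), swap_of_ge (by omega), he (i - 2) (by omega),
      show n + 2 - 2 = n by omega]
  · -- adjacency
    rcases lt_trichotomy (i + 1) (k + 1) with h1 | h1 | h1
    · rw [swap_of_le (by omega), swap_of_le (by omega)]; exact hadj i (by omega)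
    · obtain rfl : i = k := by omega
      rw [swap_of_le le_rfl, swap_k1]; exact adj_add_of_mem_units ha _
    · rcases lt_trichotomy i (k + 2) with h2 | rfl | h2
      · obtain rfl : i = k + 1 := by omega
        rw [swap_k1, show k + 1 + 1 = k + 2 by ring, swap_k2]
        have := hadj k hk
        rw [adj_iff_sub_mem_units] at this ⊢
        rwa [show ω (k + 1) + a - (ω k + a) = ω (k + 1) - ω k by abel]
      · rw [swap_k2, swap_of_ge (by omega), show k + 2 + 1 - 2 = k + 1 by omega]
        exact (adj_add_of_mem_units ha _).symm
      · rw [swap_of_ge (by omega), swap_of_ge (by omega), show i + 1 - 2 = i - 2 + 1 by omega]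
        exact hadj (i - 2) (by omega)
  · -- self-avoidance
    intro s hs t ht hst
    simp only [Set.mem_setOf_eq] at hs ht
    have hpq : ω k + a ≠ ω (k + 1) + a := by
      intro h
      have := hinj (show k ≤ n by omega) (show k + 1 ≤ n by omega) (add_right_cancel h)
      omega
    -- classify `s` and `t`
    have key : ∀ s ≤ n + 2, (s ≤ k ∧ swap k a ω s = ω s) ∨ (s = k + 1 ∧ swap k a ω s = ω k + a) ∨
        (s = k + 2 ∧ swap k a ω s = ω (k + 1) + a) ∨ (k + 3 ≤ s ∧ swap k a ω s = ω (s - 2)) := by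
      intro s _
      rcases le_or_gt s k with h | h
      · exact Or.inl ⟨h, swap_of_le h⟩
      rcases lt_trichotomy s (k + 2) with h2 | rfl | h2
      · obtain rfl : s = k + 1 := by omega
        exact Or.inr (Or.inl ⟨rfl, swap_k1⟩)
      · exact Or.inr (Or.inr (Or.inl ⟨rfl, swap_k2⟩))
      · exact Or.inr (Or.inr (Or.inr ⟨by omega, swap_of_ge (by omega)⟩))
    rcases key s hs with ⟨hs1, es⟩ | ⟨rfl, es⟩ | ⟨rfl, es⟩ | ⟨hs1, es⟩ <;>
      rcases key t ht with ⟨ht1, et⟩ | ⟨rfl, et⟩ | ⟨rfl, et⟩ | ⟨ht1, et⟩ <;>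
      have H := es.symm.trans (hst.trans et)
    · exact hinj (show s ≤ n by omega) (show t ≤ n by omega) H
    · exact absurd H (hp s (by omega))
    · exact absurd H (hq s (by omega))
    · have := hinj (show s ≤ n by omega) (show t - 2 ≤ n by omega) H; omega
    · exact absurd H.symm (hp t (by omega))
    · rfl
    · exact absurd H hpq
    · exact absurd H.symm (hp (t - 2) (by omega))
    · exact absurd H.symm (hq t (by omega))
    · exact absurd H.symm hpq
    · rfl
    · exact absurd H.symm (hq (t - 2) (by omega))
    · have := hinj (show s - 2 ≤ n by omega) (show t ≤ n by omega) H; omega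
    · exact absurd H (hp (s - 2) (by omega))
    · exact absurd H (hq (s - 2) (by omega))
    · have := hinj (show s - 2 ≤ n by omega) (show t - 2 ≤ n by omega) H; omega

/-- The sites `ω(j+3) − ω(j)` step of a contracted hairpin is the middle step. [folklore] -/
private theorem hairpin_diag (hj : hairpinAt n ω j) : ω (j + 3) - ω j = ω (j + 2) - ω (j + 1) := by
  have e := hj.2
  rw [sub_eq_iff_eq_add] at e
  rw [e]; abel

/-- **The contraction of a hairpin is a self-avoiding walk.** [folklore] -/
private theorem contract_mem_saws (hω : ω ∈ saws (d + 2) (n + 2)) (hj : hairpinAt (n + 2) ω j) :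
    contract j ω ∈ saws (d + 2) n := by
  obtain ⟨h0, he, hadj, hinj⟩ := mem_saws.1 hω
  have hjn : j + 3 ≤ n + 2 := hj.1
  rw [mem_saws]
  refine ⟨by rw [contract_of_le (Nat.zero_le j), h0], fun i hi => ?_, fun i hi => ?_, ?_⟩
  · rw [contract_of_gt (by omega), contract_of_gt (by omega), he (i + 2) (by omega)]
  · rcases lt_trichotomy (i + 1) (j + 1) with h1 | h1 | h1
    · rw [contract_of_le (by omega), contract_of_le (by omega)]; exact hadj i (by omega)
    · have hij : i = j := by omega
      rw [hij, contract_of_le le_rfl, contract_of_gt (Nat.lt_succ_self j), show j + 1 + 2 = j + 3 by ring]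
      have h2 := hadj (j + 1) (by omega)
      rw [adj_iff_sub_mem_units] at h2 ⊢
      rw [hairpin_diag hj, show j + 1 + 1 = j + 2 by ring] ; exact h2
    · rw [contract_of_gt (by omega), contract_of_gt (by omega), show i + 1 + 2 = i + 2 + 1 by ring]
      exact hadj (i + 2) (by omega)
  · intro s hs t ht hst
    simp only [Set.mem_setOf_eq] at hs ht
    rcases le_or_gt s j with hs1 | hs1 <;> rcases le_or_gt t j with ht1 | ht1
    · rw [contract_of_le hs1, contract_of_le ht1] at hst
      exact hinj (show s ≤ n + 2 by omega) (show t ≤ n + 2 by omega) hst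
    · rw [contract_of_le hs1, contract_of_gt ht1] at hst
      have := hinj (show s ≤ n + 2 by omega) (show t + 2 ≤ n + 2 by omega) hst; omega
    · rw [contract_of_gt hs1, contract_of_le ht1] at hst
      have := hinj (show s + 2 ≤ n + 2 by omega) (show t ≤ n + 2 by omega) hst; omega
    · rw [contract_of_gt hs1, contract_of_gt ht1] at hst
      have := hinj (show s + 2 ≤ n + 2 by omega) (show t + 2 ≤ n + 2 by omega) hst; omega

/-- **The contracted hairpin is a U-occurrence** of the contracted walk. [folklore] -/
private theorem isUocc_contract (hω : ω ∈ saws (d + 2) (n + 2)) (hj : hairpinAt (n + 2) ω j) :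
    IsUocc n (contract j ω) j (ω (j + 1) - ω j) := by
  obtain ⟨-, -, hadj, hinj⟩ := mem_saws.1 hω
  have hjn : j + 3 ≤ n + 2 := hj.1
  refine ⟨by omega, ?_, fun i hi => ?_, fun i hi => ?_⟩
  · have := hadj j (by omega); rwa [adj_iff_sub_mem_units] at this
  · rw [contract_of_le le_rfl, add_sub_cancel]
    rcases le_or_gt i j with h | h
    · rw [contract_of_le h]
      intro e; have := hinj (show i ≤ n + 2 by omega) (show j + 1 ≤ n + 2 by omega) e; omega
    · rw [contract_of_gt h]
      intro e; have := hinj (show i + 2 ≤ n + 2 by omega) (show j + 1 ≤ n + 2 by omega) e; omega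
  · rw [contract_of_gt (Nat.lt_succ_self j), show j + 1 + 2 = j + 3 by ring]
    have e2 : ω (j + 3) + (ω (j + 1) - ω j) = ω (j + 2) := by
      have := hairpin_diag hj
      rw [sub_eq_iff_eq_add] at this
      rw [this]; abel
    rw [e2]
    rcases le_or_gt i j with h | h
    · rw [contract_of_le h]
      intro e; have := hinj (show i ≤ n + 2 by omega) (show j + 2 ≤ n + 2 by omega) e; omega
    · rw [contract_of_gt h]
      intro e; have := hinj (show i + 2 ≤ n + 2 by omega) (show j + 2 ≤ n + 2 by omega) e; omega

end SwapLemmas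

/-! ### Counting the pairs in two ways -/

section Pairs

variable {n : ℕ}

open Classical in
/-- The pairs `(ω, (k, a))`: a walk and one of its U-occurrences. [folklore] -/
private def uPairs (n : ℕ) : Finset ((ℕ → Site (d + 2)) × (ℕ × Site (d + 2))) :=
  (saws (d + 2) n ×ˢ (Finset.range n ×ˢ units)).filter fun p => IsUocc n p.1 p.2.1 p.2.2

open Classical in
/-- The pairs `(ω, j)`: a walk and one of its hairpins. [folklore] -/
private def hPairs (n : ℕ) : Finset ((ℕ → Site (d + 2)) × ℕ) :=
  (saws (d + 2) n ×ˢ Finset.range (n + 1)).filter fun p => hairpinAt n p.1 p.2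

open Classical in
/-- Membership in `uPairs`. [folklore] -/
private theorem mem_uPairs {p : (ℕ → Site (d + 2)) × (ℕ × Site (d + 2))} :
    p ∈ uPairs n ↔ p.1 ∈ saws (d + 2) n ∧ IsUocc n p.1 p.2.1 p.2.2 := by
  unfold uPairs
  rw [Finset.mem_filter, Finset.mem_product, Finset.mem_product, Finset.mem_range]
  exact ⟨fun h => ⟨h.1.1, h.2⟩, fun h => ⟨⟨h.1, h.2.1, h.2.2.1⟩, h.2⟩⟩

open Classical in
/-- Membership in `hPairs`. [folklore] -/
private theorem mem_hPairs {p : (ℕ → Site (d + 2)) × ℕ} :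
    p ∈ hPairs n ↔ p.1 ∈ saws (d + 2) n ∧ hairpinAt n p.1 p.2 := by
  unfold hPairs
  rw [Finset.mem_filter, Finset.mem_product, Finset.mem_range]
  exact ⟨fun h => ⟨h.1.1, h.2⟩, fun h => ⟨⟨h.1, by have := h.2.1; omega⟩, h.2⟩⟩

/-- Summing over U-pairs is summing `I(ω) F(ω)` over walks. [folklore] -/
private theorem sum_uPairs (F : (ℕ → Site (d + 2)) → ℝ) :
    ∑ p ∈ uPairs (d := d) n, F p.1 = ∑ ω ∈ saws (d + 2) n, (ucount n ω : ℝ) * F ω := by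
  classical
  unfold uPairs
  rw [Finset.sum_filter, Finset.sum_product]
  refine Finset.sum_congr rfl fun ω _ => ?_
  rw [Finset.sum_ite, Finset.sum_const_zero, add_zero]
  dsimp only
  rw [Finset.sum_const, nsmul_eq_mul]
  rfl

/-- Summing over hairpin pairs is summing `J(ω) F(ω)` over walks. [folklore] -/
private theorem sum_hPairs (F : (ℕ → Site (d + 2)) → ℝ) :
    ∑ p ∈ hPairs (d := d) n, F p.1 = ∑ ω ∈ saws (d + 2) n, (hcount n ω : ℝ) * F ω := by
  classical
  unfold hPairs
  rw [Finset.sum_filter, Finset.sum_product]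
  refine Finset.sum_congr rfl fun ω _ => ?_
  rw [Finset.sum_ite, Finset.sum_const_zero, add_zero]
  dsimp only
  rw [Finset.sum_const, nsmul_eq_mul]
  rfl

/-- **Counting the pairs in two ways**: `(ω, (k,a)) ↦ (swap, k)` is a bijection from the U-pairs of `S_n` onto
the hairpin pairs of `S_{n+2}` (inverse: contraction). [cite: MadrasSlade1993, Theorem 7.3.2 (proof), eq. (7.3.6)
(hairpin variant)] -/
private theorem sum_uPairs_eq_sum_hPairs (F : (ℕ → Site (d + 2)) × (ℕ × Site (d + 2)) → ℝ)
    (G : (ℕ → Site (d + 2)) × ℕ → ℝ)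
    (h : ∀ p ∈ uPairs (d := d) n, F p = G (swap p.2.1 p.2.2 p.1, p.2.1)) :
    ∑ p ∈ uPairs (d := d) n, F p = ∑ q ∈ hPairs (d := d) (n + 2), G q := by
  refine Finset.sum_nbij' (fun p => (swap p.2.1 p.2.2 p.1, p.2.1))
    (fun q => (contract q.2 q.1, (q.2, q.1 (q.2 + 1) - q.1 q.2))) ?_ ?_ ?_ ?_ h
  · intro p hp
    obtain ⟨hω, hu⟩ := mem_uPairs.1 hp
    exact mem_hPairs.2 ⟨swap_mem_saws hω hu, hairpinAt_swap hu.1⟩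
  · intro q hq
    obtain ⟨hω, hj⟩ := mem_hPairs.1 hq
    exact mem_uPairs.2 ⟨contract_mem_saws hω hj, isUocc_contract hω hj⟩
  · intro p hp
    simp only [contract_swap, swap_k1_sub]
  · intro q hq
    obtain ⟨-, hj⟩ := mem_hPairs.1 hq
    simp only [swap_contract hj]

end Pairs

/-! ### The local bounds: bookkeeping changes by bounded amounts -/

section LocalBounds

variable {n k : ℕ} {a : Site (d + 2)} {ω : ℕ → Site (d + 2)}

/-- A hairpin of `ω` away from the step `k` is a hairpin of the swap (shifted by `2` beyond `k`). [folklore] -/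
private theorem hairpinAt_swap_of_far {j : ℕ} (hj : hairpinAt n ω j) (hfar : j + 3 ≤ k ∨ k + 1 ≤ j) :
    hairpinAt (n + 2) (swap k a ω) (if j + 3 ≤ k then j else j + 2) := by
  obtain ⟨hjn, hje⟩ := hj
  rcases hfar with h | h
  · rw [if_pos h]
    refine ⟨by omega, ?_⟩
    rw [swap_of_le (by omega), swap_of_le (by omega), swap_of_le (by omega), swap_of_le (by omega)]
    exact hje
  · rw [if_neg (by omega)]
    refine ⟨by omega, ?_⟩
    rw [swap_of_ge (by omega), swap_of_ge (by omega), swap_of_ge (by omega), swap_of_ge (by omega),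
      show j + 2 + 3 - 2 = j + 3 by omega, show j + 2 + 2 - 2 = j + 2 by omega,
      show j + 2 - 2 = j by omega, show j + 2 + 1 - 2 = j + 1 by omega]
    exact hje

/-- A hairpin of the swap away from the three new steps is a hairpin of `ω` (shifted back). [folklore] -/
private theorem hairpinAt_of_swap_far (hk : k < n) {j : ℕ} (hj : hairpinAt (n + 2) (swap k a ω) j)
    (hfar : j + 3 ≤ k ∨ k + 3 ≤ j) : hairpinAt n ω (if j + 3 ≤ k then j else j - 2) := by
  obtain ⟨hjn, hje⟩ := hj
  rcases hfar with h | h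
  · rw [if_pos h]
    refine ⟨by omega, ?_⟩
    rw [swap_of_le (by omega), swap_of_le (by omega), swap_of_le (by omega), swap_of_le (by omega)] at hje
    exact hje
  · rw [if_neg (by omega)]
    refine ⟨by omega, ?_⟩
    rw [swap_of_ge (by omega), swap_of_ge (by omega), swap_of_ge (by omega), swap_of_ge (by omega)] at hje
    rw [show j - 2 + 3 = j + 3 - 2 by omega, show j - 2 + 2 = j + 2 - 2 by omega,
      show j - 2 + 1 = j + 1 - 2 by omega]
    exact hje

/-- **`J(swap) ≥ J(ω) − 3`**: at most the three hairpins meeting the step `k` are lost. [folklore] -/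
private theorem hcount_le_hcount_swap : hcount n ω ≤ hcount (n + 2) (swap k a ω) + 3 := by
  classical
  unfold hcount occ
  set S := (Finset.range (n + 1)).filter (hairpinAt n ω) with hS
  set S' := (Finset.range (n + 2 + 1)).filter (hairpinAt (n + 2) (swap k a ω)) with hS'
  set near : ℕ → Prop := fun j => k ≤ j + 2 ∧ j ≤ k with hnear
  have h1 : (S.filter near).card ≤ 3 := by
    calc (S.filter near).card ≤ ({k - 2, k - 1, k} : Finset ℕ).card := by
          refine Finset.card_le_card fun j hj => ?_
          have := (Finset.mem_filter.1 hj).2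
          simp only [Finset.mem_insert, Finset.mem_singleton]
          omega
      _ ≤ 3 := Finset.card_le_three
  have h2 : (S.filter fun j => ¬ near j).card ≤ S'.card := by
    refine Finset.card_le_card_of_injOn (fun j => if j + 3 ≤ k then j else j + 2) (fun j hj => ?_) ?_
    · obtain ⟨hjS, hjn⟩ := Finset.mem_filter.1 hj
      obtain ⟨hjr, hjh⟩ := Finset.mem_filter.1 hjS
      have hfar : j + 3 ≤ k ∨ k + 1 ≤ j := by
        simp only [hnear, not_and_or, not_le] at hjn; omega
      have hm := hairpinAt_swap_of_far (a := a) hjh hfar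
      refine Finset.mem_coe.2 (Finset.mem_filter.2 ⟨Finset.mem_range.2 ?_, hm⟩)
      have h3 := hm.1
      dsimp only at h3 ⊢
      split_ifs at h3 ⊢ <;> omega
    · intro j hj j' hj' hjj
      have hjn := (Finset.mem_filter.1 (Finset.mem_coe.1 hj)).2
      have hjn' := (Finset.mem_filter.1 (Finset.mem_coe.1 hj')).2
      simp only [hnear, not_and_or, not_le] at hjn hjn'
      simp only at hjj
      split_ifs at hjj <;> omega
  rw [← Finset.card_filter_add_card_filter_not (s := S) near]
  omega

/-- **`J(swap) ≤ J(ω) + 5`**: at most the five windows meeting the three new steps are new. [folklore] -/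
private theorem hcount_swap_le (hk : k < n) : hcount (n + 2) (swap k a ω) ≤ hcount n ω + 5 := by
  classical
  unfold hcount occ
  set S := (Finset.range (n + 1)).filter (hairpinAt n ω) with hS
  set S' := (Finset.range (n + 2 + 1)).filter (hairpinAt (n + 2) (swap k a ω)) with hS'
  set near : ℕ → Prop := fun j => k ≤ j + 2 ∧ j ≤ k + 2 with hnear
  have h1 : (S'.filter near).card ≤ 5 := by
    calc (S'.filter near).card ≤ (Finset.Icc (k - 2) (k + 2)).card := by
          refine Finset.card_le_card fun j hj => ?_
          have := (Finset.mem_filter.1 hj).2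
          rw [Finset.mem_Icc]; omega
      _ ≤ 5 := by rw [Nat.card_Icc]; omega
  have h2 : (S'.filter fun j => ¬ near j).card ≤ S.card := by
    refine Finset.card_le_card_of_injOn (fun j => if j + 3 ≤ k then j else j - 2) (fun j hj => ?_) ?_
    · obtain ⟨hjS, hjn⟩ := Finset.mem_filter.1 hj
      obtain ⟨hjr, hjh⟩ := Finset.mem_filter.1 hjS
      have hfar : j + 3 ≤ k ∨ k + 3 ≤ j := by
        simp only [hnear, not_and_or, not_le] at hjn; omega
      have hm := hairpinAt_of_swap_far hk hjh hfar
      refine Finset.mem_coe.2 (Finset.mem_filter.2 ⟨Finset.mem_range.2 ?_, hm⟩)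
      have h3 := hm.1
      dsimp only at h3 ⊢
      split_ifs at h3 ⊢ <;> omega
    · intro j hj j' hj' hjj
      have hjn := (Finset.mem_filter.1 (Finset.mem_coe.1 hj)).2
      have hjn' := (Finset.mem_filter.1 (Finset.mem_coe.1 hj')).2
      simp only [hnear, not_and_or, not_le] at hjn hjn'
      simp only at hjj
      split_ifs at hjj <;> omega
  rw [← Finset.card_filter_add_card_filter_not (s := S') near]
  omega

/-- The image of a U-occurrence `(k', a')` of `ω`, `k' ≠ k`, in the swap. [folklore] -/
private def shiftK (k k' : ℕ) : ℕ := if k' < k then k' else k' + 2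

/-- The swap at the shifted index. [folklore] -/
private theorem swap_shiftK {k' : ℕ} (hk' : k' ≠ k) : swap k a ω (shiftK k k') = ω k' := by
  unfold shiftK; split_ifs with h
  · exact swap_of_le h.le
  · rw [swap_of_ge (by omega)]; rfl

/-- The swap after the shifted index. [folklore] -/
private theorem swap_shiftK_succ (k' : ℕ) : swap k a ω (shiftK k k' + 1) = ω (k' + 1) := by
  unfold shiftK; split_ifs with h
  · exact swap_of_le (by omega)
  · rw [swap_of_ge (by omega), show k' + 2 + 1 - 2 = k' + 1 by omega]

/-- A U-occurrence of `ω` off the step `k` whose two outside sites avoid the two new sites is a U-occurrence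
of the swap. [folklore] -/
private theorem isUocc_swap {k' : ℕ} {a' : Site (d + 2)} (hu : IsUocc n ω k a)
    (hu' : IsUocc n ω k' a') (hk' : k' ≠ k)
    (h1 : ω k' + a' ≠ ω k + a) (h2 : ω k' + a' ≠ ω (k + 1) + a)
    (h3 : ω (k' + 1) + a' ≠ ω k + a) (h4 : ω (k' + 1) + a' ≠ ω (k + 1) + a) :
    IsUocc (n + 2) (swap k a ω) (shiftK k k') a' := by
  obtain ⟨hk'n, ha', hp', hq'⟩ := hu'
  have hkn : k < n := hu.1
  have hsk : shiftK k k' < n + 2 := by unfold shiftK; split_ifs <;> omega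
  refine ⟨hsk, ha', fun i hi => ?_, fun i hi => ?_⟩
  · rw [swap_shiftK hk']
    rcases le_or_gt i k with h | h
    · rw [swap_of_le h]; exact hp' i (by omega)
    rcases lt_trichotomy i (k + 2) with h5 | rfl | h5
    · obtain rfl : i = k + 1 := by omega
      rw [swap_k1]; exact h1.symm
    · rw [swap_k2]; exact h2.symm
    · rw [swap_of_ge (by omega)]; exact hp' (i - 2) (by omega)
  · rw [swap_shiftK_succ k']
    rcases le_or_gt i k with h | h
    · rw [swap_of_le h]; exact hq' i (by omega)
    rcases lt_trichotomy i (k + 2) with h5 | rfl | h5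
    · obtain rfl : i = k + 1 := by omega
      rw [swap_k1]; exact h3.symm
    · rw [swap_k2]; exact h4.symm
    · rw [swap_of_ge (by omega)]; exact hq' (i - 2) (by omega)

/-- For a fixed site `z` and `e ∈ {0,1}`, at most `2(d+2)` U-occurrences `(k', a')` have `ω(k'+e) + a' = z`.
[folklore] -/
private theorem card_filter_hit_le (hω : ω ∈ saws (d + 2) n) (z : Site (d + 2)) (e : ℕ) (he : e ≤ 1) :
    ((uocc n ω).filter fun p => ω (p.1 + e) + p.2 = z).card ≤ 2 * (d + 2) := by
  classical
  obtain ⟨-, -, -, hinj⟩ := mem_saws.1 hω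
  refine (Finset.card_le_card_of_injOn (fun p => p.2) (fun p hp => ?_) ?_).trans card_units_le
  · exact Finset.mem_coe.2 (mem_uocc.1 (Finset.mem_filter.1 hp).1).2.1
  · intro p hp p' hp' h
    obtain ⟨hpU, hpz⟩ := Finset.mem_filter.1 (Finset.mem_coe.1 hp)
    obtain ⟨hpU', hpz'⟩ := Finset.mem_filter.1 (Finset.mem_coe.1 hp')
    have hk1 := (mem_uocc.1 hpU).1
    have hk2 := (mem_uocc.1 hpU').1
    simp only at h
    have e1 : ω (p.1 + e) = ω (p'.1 + e) := by
      have := hpz.trans hpz'.symm; rw [h] at this; exact add_right_cancel this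
    have := hinj (show p.1 + e ≤ n by omega) (show p'.1 + e ≤ n by omega) e1
    exact Prod.ext (by omega) h

/-- **`I(swap) ≥ I(ω) − 10(d+2)`**: besides the (at most `2(d+2)`) U-occurrences on the step `k` itself, only those
whose outside sites hit one of the two new sites are lost (at most `2(d+2)` for each of the four incidences).
[folklore] -/
private theorem ucount_le_ucount_swap (hω : ω ∈ saws (d + 2) n) (hu : IsUocc n ω k a) :
    ucount n ω ≤ ucount (n + 2) (swap k a ω) + 10 * (d + 2) := by
  classical
  set p₀ := ω k + a with hp₀
  set q₀ := ω (k + 1) + a with hq₀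
  set bad : ℕ × Site (d + 2) → Prop := fun p =>
    p.1 = k ∨ ω (p.1 + 0) + p.2 = p₀ ∨ ω (p.1 + 0) + p.2 = q₀ ∨ ω (p.1 + 1) + p.2 = p₀ ∨ ω (p.1 + 1) + p.2 = q₀
    with hbad
  have hbad_iff : ∀ p, bad p ↔ (p.1 = k ∨ ω (p.1 + 0) + p.2 = p₀ ∨ ω (p.1 + 0) + p.2 = q₀ ∨
      ω (p.1 + 1) + p.2 = p₀ ∨ ω (p.1 + 1) + p.2 = q₀) := fun p => Iff.rfl
  unfold ucount
  -- the bad ones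
  have hB : ((uocc n ω).filter bad).card ≤ 10 * (d + 2) := by
    set A1 := (uocc n ω).filter (fun p => p.1 = k)
    set A2 := (uocc n ω).filter (fun p => ω (p.1 + 0) + p.2 = p₀)
    set A3 := (uocc n ω).filter (fun p => ω (p.1 + 0) + p.2 = q₀)
    set A4 := (uocc n ω).filter (fun p => ω (p.1 + 1) + p.2 = p₀)
    set A5 := (uocc n ω).filter (fun p => ω (p.1 + 1) + p.2 = q₀)
    have e : (uocc n ω).filter bad = A1 ∪ A2 ∪ A3 ∪ A4 ∪ A5 := by
      ext p; simp only [hbad_iff, Finset.mem_filter, Finset.mem_union, A1, A2, A3, A4, A5]; tauto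
    have hk0 : A1.card ≤ 2 * (d + 2) := by
      refine (Finset.card_le_card_of_injOn (fun p => p.2) (fun p hp => ?_) ?_).trans card_units_le
      · exact Finset.mem_coe.2 (mem_uocc.1 (Finset.mem_filter.1 hp).1).2.1
      · intro p hp p' hp' h
        have h1 := (Finset.mem_filter.1 (Finset.mem_coe.1 hp)).2
        have h2 := (Finset.mem_filter.1 (Finset.mem_coe.1 hp')).2
        exact Prod.ext (by omega) h
    rw [e]
    have c5 := Finset.card_union_le (A1 ∪ A2 ∪ A3 ∪ A4) A5
    have c4 := Finset.card_union_le (A1 ∪ A2 ∪ A3) A4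
    have c3 := Finset.card_union_le (A1 ∪ A2) A3
    have c2 := Finset.card_union_le A1 A2
    have b2 : A2.card ≤ 2 * (d + 2) := card_filter_hit_le hω p₀ 0 (by norm_num)
    have b3 : A3.card ≤ 2 * (d + 2) := card_filter_hit_le hω q₀ 0 (by norm_num)
    have b4 : A4.card ≤ 2 * (d + 2) := card_filter_hit_le hω p₀ 1 le_rfl
    have b5 : A5.card ≤ 2 * (d + 2) := card_filter_hit_le hω q₀ 1 le_rfl
    omega
  -- the good ones inject
  have hG : ((uocc n ω).filter fun p => ¬ bad p).card ≤ (uocc (n + 2) (swap k a ω)).card := by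
    refine Finset.card_le_card_of_injOn (fun p => (shiftK k p.1, p.2)) (fun p hp => ?_) ?_
    · obtain ⟨hpU, hpb⟩ := Finset.mem_filter.1 hp
      simp only [hbad, not_or, add_zero] at hpb
      obtain ⟨hk', h1, h2, h3, h4⟩ := hpb
      exact Finset.mem_coe.2 (mem_uocc.2 (isUocc_swap hu (mem_uocc.1 hpU) hk' h1 h2 h3 h4))
    · intro p hp p' hp' h
      have hb := (Finset.mem_filter.1 (Finset.mem_coe.1 hp)).2
      have hb' := (Finset.mem_filter.1 (Finset.mem_coe.1 hp')).2
      rw [hbad_iff] at hb hb'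
      simp only [not_or] at hb hb'
      simp only [Prod.mk.injEq] at h
      refine Prod.ext ?_ h.2
      have h1 := h.1
      unfold shiftK at h1
      split_ifs at h1 <;> omega
  rw [← Finset.card_filter_add_card_filter_not (s := uocc n ω) bad]
  omega

end LocalBounds

/-! ### The robust chain (7.3.6')–(7.3.8') -/

section Chain

variable {n k : ℕ} {a : Site (d + 2)} {ω : ℕ → Site (d + 2)}

/-- The swap has at least one hairpin. [folklore] -/
private theorem one_le_hcount_swap (hk : k < n) : 1 ≤ hcount (n + 2) (swap k a ω) := by
  classical
  unfold hcount occ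
  exact Finset.card_pos.2 ⟨k, Finset.mem_filter.2 ⟨Finset.mem_range.2 (by omega), hairpinAt_swap hk⟩⟩

/-- **(7.3.6'), upper bound for `c_{N+2}`**: `c_{N+2} ≤ #{ω' ∈ S_{N+2} : J = 0} + Σ_{ω ∈ S_N} I(ω)/max(J(ω) − 3, 1)`
(each `ω'` with `J ≥ 1` is hit `J(ω')` times by the swap, and `J(swap ω) ≥ max(J(ω) − 3, 1)`).
[cite: MadrasSlade1993, Theorem 7.3.2 (proof), eq. (7.3.6) (hairpin variant)] -/
theorem count_add_two_le (N : ℕ) :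
    (count (d + 2) (N + 2) : ℝ) ≤
      (((saws (d + 2) (N + 2)).filter fun ω => hcount (N + 2) ω = 0).card : ℝ) +
        ∑ ω ∈ saws (d + 2) N, (ucount N ω : ℝ) / max ((hcount N ω : ℝ) - 3) 1 := by
  classical
  have hsplit : (count (d + 2) (N + 2) : ℝ) =
      (((saws (d + 2) (N + 2)).filter fun ω => hcount (N + 2) ω = 0).card : ℝ) +
        (((saws (d + 2) (N + 2)).filter fun ω => ¬ hcount (N + 2) ω = 0).card : ℝ) := by
    rw [← card_saws]
    exact_mod_cast (Finset.card_filter_add_card_filter_not (s := saws (d + 2) (N + 2))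
      (fun ω => hcount (N + 2) ω = 0)).symm
  have h1 : (((saws (d + 2) (N + 2)).filter fun ω => ¬ hcount (N + 2) ω = 0).card : ℝ) =
      ∑ q ∈ hPairs (d := d) (N + 2), 1 / (hcount (N + 2) q.1 : ℝ) := by
    rw [sum_hPairs (n := N + 2) (F := fun ω => 1 / (hcount (N + 2) ω : ℝ)), Finset.card_eq_sum_ones,
      Nat.cast_sum, Finset.sum_filter]
    refine Finset.sum_congr rfl fun ω _ => ?_
    by_cases h : hcount (N + 2) ω = 0
    · rw [if_neg (not_not.2 h), h]; simp
    · rw [if_pos h, mul_one_div_cancel (by exact_mod_cast h)]; simp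
  have h2 : ∑ p ∈ uPairs (d := d) N, 1 / (hcount (N + 2) (swap p.2.1 p.2.2 p.1) : ℝ) =
      ∑ q ∈ hPairs (d := d) (N + 2), 1 / (hcount (N + 2) q.1 : ℝ) :=
    sum_uPairs_eq_sum_hPairs _ (fun q => 1 / (hcount (N + 2) q.1 : ℝ)) fun p _ => rfl
  have h3 : ∑ p ∈ uPairs (d := d) N, 1 / (hcount (N + 2) (swap p.2.1 p.2.2 p.1) : ℝ) ≤
      ∑ p ∈ uPairs (d := d) N, 1 / max ((hcount N p.1 : ℝ) - 3) 1 := by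
    refine Finset.sum_le_sum fun p hp => ?_
    obtain ⟨-, hu⟩ := mem_uPairs.1 hp
    have hJ1 := one_le_hcount_swap (a := p.2.2) (ω := p.1) hu.1
    have hJ3 := hcount_le_hcount_swap (n := N) (k := p.2.1) (a := p.2.2) (ω := p.1)
    apply one_div_le_one_div_of_le (by positivity)
    apply max_le
    · have : (hcount N p.1 : ℝ) ≤ hcount (N + 2) (swap p.2.1 p.2.2 p.1) + 3 := by exact_mod_cast hJ3
      linarith
    · exact_mod_cast hJ1
  have h4 : ∑ p ∈ uPairs (d := d) N, 1 / max ((hcount N p.1 : ℝ) - 3) 1 =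
      ∑ ω ∈ saws (d + 2) N, (ucount N ω : ℝ) / max ((hcount N ω : ℝ) - 3) 1 := by
    rw [sum_uPairs (F := fun ω => 1 / max ((hcount N ω : ℝ) - 3) 1)]
    refine Finset.sum_congr rfl fun ω _ => ?_
    rw [mul_one_div]
  rw [hsplit, h1, ← h2]
  linarith [h4.le]

/-- **(7.3.7'), lower bound for `c_{N+4}`**:
`Σ_{ω ∈ S_N} I(ω)(I(ω) − c₀)/((J(ω)+5)(J(ω)+10)) ≤ c_{N+4}`, `c₀ = 10(d+2)` (double swaps; the preimage
multiplicities and the changes of `I`, `J` are controlled by the local bounds).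
[cite: MadrasSlade1993, Theorem 7.3.2 (proof), eq. (7.3.7) (hairpin variant)] -/
theorem sum_le_count_add_four (N : ℕ) :
    ∑ ω ∈ saws (d + 2) N, (ucount N ω : ℝ) * ((ucount N ω : ℝ) - 10 * (d + 2)) /
        (((hcount N ω : ℝ) + 5) * ((hcount N ω : ℝ) + 10)) ≤ (count (d + 2) (N + 4) : ℝ) := by
  classical
  -- level `N + 2`
  have hA : ∑ ω' ∈ saws (d + 2) (N + 2), (ucount (N + 2) ω' : ℝ) / ((hcount (N + 2) ω' : ℝ) + 5) ≤
      count (d + 2) (N + 4) := by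
    have e1 : ∑ ω' ∈ saws (d + 2) (N + 2), (ucount (N + 2) ω' : ℝ) / ((hcount (N + 2) ω' : ℝ) + 5) =
        ∑ p ∈ uPairs (d := d) (N + 2), 1 / ((hcount (N + 2) p.1 : ℝ) + 5) := by
      rw [sum_uPairs (F := fun ω => 1 / ((hcount (N + 2) ω : ℝ) + 5))]
      refine Finset.sum_congr rfl fun ω _ => ?_
      rw [mul_one_div]
    have e2 : ∑ p ∈ uPairs (d := d) (N + 2), 1 / ((hcount (N + 2) p.1 : ℝ) + 5) ≤
        ∑ p ∈ uPairs (d := d) (N + 2), 1 / (hcount (N + 2 + 2) (swap p.2.1 p.2.2 p.1) : ℝ) := by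
      refine Finset.sum_le_sum fun p hp => ?_
      obtain ⟨-, hu⟩ := mem_uPairs.1 hp
      have hJ1 := one_le_hcount_swap (a := p.2.2) (ω := p.1) hu.1
      have hJ5 := hcount_swap_le (a := p.2.2) (ω := p.1) hu.1
      have hpos : (0 : ℝ) < hcount (N + 2 + 2) (swap p.2.1 p.2.2 p.1) := by exact_mod_cast hJ1
      apply one_div_le_one_div_of_le hpos
      exact_mod_cast hJ5
    have e3 : ∑ p ∈ uPairs (d := d) (N + 2), 1 / (hcount (N + 2 + 2) (swap p.2.1 p.2.2 p.1) : ℝ) =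
        ∑ q ∈ hPairs (d := d) (N + 2 + 2), 1 / (hcount (N + 2 + 2) q.1 : ℝ) :=
      sum_uPairs_eq_sum_hPairs _ (fun q => 1 / (hcount (N + 2 + 2) q.1 : ℝ)) fun p _ => rfl
    have e4 : ∑ q ∈ hPairs (d := d) (N + 2 + 2), 1 / (hcount (N + 2 + 2) q.1 : ℝ) ≤ count (d + 2) (N + 4) := by
      rw [sum_hPairs (n := N + 2 + 2) (F := fun ω => 1 / (hcount (N + 2 + 2) ω : ℝ)),
        show N + 4 = N + 2 + 2 by ring, ← card_saws, Finset.card_eq_sum_ones, Nat.cast_sum]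
      refine Finset.sum_le_sum fun ω _ => ?_
      by_cases h : hcount (N + 2 + 2) ω = 0
      · rw [h]; simp
      · rw [mul_one_div_cancel (by exact_mod_cast h)]; simp
    rw [e1]; exact e2.trans (e3.le.trans e4)
  refine le_trans ?_ hA
  -- level `N`
  set g : (ℕ → Site (d + 2)) → ℝ := fun ω' =>
    (ucount (N + 2) ω' : ℝ) / (((hcount (N + 2) ω' : ℝ) + 5) * (hcount (N + 2) ω' : ℝ)) with hg
  have hB : ∑ ω' ∈ saws (d + 2) (N + 2), (hcount (N + 2) ω' : ℝ) * g ω' ≤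
      ∑ ω' ∈ saws (d + 2) (N + 2), (ucount (N + 2) ω' : ℝ) / ((hcount (N + 2) ω' : ℝ) + 5) := by
    refine Finset.sum_le_sum fun ω' _ => ?_
    by_cases h : hcount (N + 2) ω' = 0
    · rw [h]; simp only [Nat.cast_zero, zero_mul, zero_add]; positivity
    · have hpos : (0 : ℝ) < hcount (N + 2) ω' := by exact_mod_cast Nat.pos_of_ne_zero h
      rw [hg]; simp only
      rw [show (hcount (N + 2) ω' : ℝ) * ((ucount (N + 2) ω' : ℝ) /
          (((hcount (N + 2) ω' : ℝ) + 5) * (hcount (N + 2) ω' : ℝ))) =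
          (ucount (N + 2) ω' : ℝ) / ((hcount (N + 2) ω' : ℝ) + 5) by field_simp]
  refine le_trans ?_ hB
  rw [← sum_hPairs (n := N + 2) (F := g)]
  rw [← sum_uPairs_eq_sum_hPairs (fun p => g (swap p.2.1 p.2.2 p.1)) (fun q => g q.1) fun p _ => rfl]
  rw [show ∑ ω ∈ saws (d + 2) N, (ucount N ω : ℝ) * ((ucount N ω : ℝ) - 10 * (d + 2)) /
      (((hcount N ω : ℝ) + 5) * ((hcount N ω : ℝ) + 10)) =
      ∑ ω ∈ saws (d + 2) N, (ucount N ω : ℝ) * (((ucount N ω : ℝ) - 10 * (d + 2)) /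
      (((hcount N ω : ℝ) + 5) * ((hcount N ω : ℝ) + 10))) from
    Finset.sum_congr rfl fun ω _ => by rw [mul_div_assoc]]
  rw [← sum_uPairs (F := fun ω => ((ucount N ω : ℝ) - 10 * (d + 2)) /
      (((hcount N ω : ℝ) + 5) * ((hcount N ω : ℝ) + 10)))]
  refine Finset.sum_le_sum fun p hp => ?_
  obtain ⟨hω, hu⟩ := mem_uPairs.1 hp
  set ω' := swap p.2.1 p.2.2 p.1 with hω'
  have hJ1 : (1 : ℝ) ≤ hcount (N + 2) ω' := by exact_mod_cast one_le_hcount_swap (a := p.2.2) (ω := p.1) hu.1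
  have hJ5 : (hcount (N + 2) ω' : ℝ) ≤ hcount N p.1 + 5 := by
    exact_mod_cast hcount_swap_le (a := p.2.2) (ω := p.1) hu.1
  have hI : (ucount N p.1 : ℝ) ≤ ucount (N + 2) ω' + 10 * (d + 2) := by
    exact_mod_cast ucount_le_ucount_swap hω hu
  have hJ0 : (0 : ℝ) ≤ hcount N p.1 := Nat.cast_nonneg _
  have hI0 : (0 : ℝ) ≤ ucount (N + 2) ω' := Nat.cast_nonneg _
  show ((ucount N p.1 : ℝ) - 10 * (d + 2)) / (((hcount N p.1 : ℝ) + 5) * ((hcount N p.1 : ℝ) + 10)) ≤ g ω'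
  rw [hg]; simp only
  have hden : ((hcount (N + 2) ω' : ℝ) + 5) * (hcount (N + 2) ω' : ℝ) ≤
      ((hcount N p.1 : ℝ) + 5) * ((hcount N p.1 : ℝ) + 10) := by nlinarith
  have hden0 : 0 < ((hcount (N + 2) ω' : ℝ) + 5) * (hcount (N + 2) ω' : ℝ) := by positivity
  rcases le_or_gt ((ucount N p.1 : ℝ) - 10 * (d + 2)) 0 with hneg | hpos
  · exact (div_nonpos_of_nonpos_of_nonneg hneg (by positivity)).trans (div_nonneg hI0 hden0.le)
  · calc ((ucount N p.1 : ℝ) - 10 * (d + 2)) / (((hcount N p.1 : ℝ) + 5) * ((hcount N p.1 : ℝ) + 10))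
        ≤ ((ucount N p.1 : ℝ) - 10 * (d + 2)) / (((hcount (N + 2) ω' : ℝ) + 5) * (hcount (N + 2) ω' : ℝ)) :=
          div_le_div_of_nonneg_left hpos.le hden0 hden
      _ ≤ (ucount (N + 2) ω' : ℝ) / (((hcount (N + 2) ω' : ℝ) + 5) * (hcount (N + 2) ω' : ℝ)) :=
          div_le_div_of_nonneg_right (by linarith) hden0.le

end Chain

/-! ### Theorem 7.3.2 (a) with an explicit constant from hairpin sparsity -/

section Assembly

/-- The far term of `Ξ_N`: for `m ≥ λN`, `m ≥ 1`, `0 ≤ I ≤ AN`,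
`(I/m)² − I(I−c)/((m+8)(m+13)) ≤ (125A²/λ³ + cA/λ²)/N`. [folklore] -/
private theorem xi_far {I m c A lam Nr : ℝ} (hm1 : 1 ≤ m) (hlam : 0 < lam) (hN : 0 < Nr) (hmN : lam * Nr ≤ m)
    (hI0 : 0 ≤ I) (hIA : I ≤ A * Nr) (hc : 0 ≤ c) :
    (I / m) ^ 2 - I * (I - c) / ((m + 8) * (m + 13)) ≤ (125 * A ^ 2 / lam ^ 3 + c * A / lam ^ 2) / Nr := by
  have hm0 : 0 < m := by linarith
  have hD0 : 0 < (m + 8) * (m + 13) := by positivity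
  have hlN : 0 < lam * Nr := by positivity
  have hANr : 0 ≤ A * Nr := hI0.trans hIA
  have e : (I / m) ^ 2 - I * (I - c) / ((m + 8) * (m + 13)) =
      I ^ 2 * (21 * m + 104) / (m ^ 2 * ((m + 8) * (m + 13))) + c * I / ((m + 8) * (m + 13)) := by
    field_simp
    ring
  rw [e]
  have h1 : I ^ 2 * (21 * m + 104) / (m ^ 2 * ((m + 8) * (m + 13))) ≤ 125 * I ^ 2 / m ^ 3 := by
    rw [div_le_div_iff₀ (by positivity) (by positivity)]
    have : (21 * m + 104) * m ^ 3 ≤ 125 * (m ^ 2 * ((m + 8) * (m + 13))) := by nlinarith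
    nlinarith [sq_nonneg I]
  have h2 : 125 * I ^ 2 / m ^ 3 ≤ 125 * (A * Nr) ^ 2 / (lam * Nr) ^ 3 := by
    apply div_le_div₀ (by positivity) (by nlinarith) (by positivity)
    exact pow_le_pow_left₀ hlN.le hmN 3
  have h3 : 125 * (A * Nr) ^ 2 / (lam * Nr) ^ 3 = 125 * A ^ 2 / lam ^ 3 / Nr := by
    field_simp
  have h4 : c * I / ((m + 8) * (m + 13)) ≤ c * I / m ^ 2 :=
    div_le_div_of_nonneg_left (by positivity) (by positivity) (by nlinarith)
  have h5 : c * I / m ^ 2 ≤ c * (A * Nr) / (lam * Nr) ^ 2 := by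
    apply div_le_div₀ (by positivity) (by nlinarith) (by positivity)
    exact pow_le_pow_left₀ hlN.le hmN 2
  have h6 : c * (A * Nr) / (lam * Nr) ^ 2 = c * A / lam ^ 2 / Nr := by
    field_simp
  rw [h3] at h2; rw [h6] at h5
  have : 125 * A ^ 2 / lam ^ 3 / Nr + c * A / lam ^ 2 / Nr = (125 * A ^ 2 / lam ^ 3 + c * A / lam ^ 2) / Nr := by
    ring
  linarith

/-- The near term of `Ξ_N`: always `(I/m)² − I(I−c)/((J+5)(J+10)) ≤ (AN)² + c(AN)`. [folklore] -/
private theorem xi_near {I m c A Nr J : ℝ} (hm1 : 1 ≤ m) (hI0 : 0 ≤ I) (hIA : I ≤ A * Nr) (hc : 0 ≤ c) (hJ : 0 ≤ J) :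
    (I / m) ^ 2 - I * (I - c) / ((J + 5) * (J + 10)) ≤ (A * Nr) ^ 2 + c * (A * Nr) := by
  have h1 : (I / m) ^ 2 ≤ (A * Nr) ^ 2 := by
    have : I / m ≤ I := div_le_self hI0 hm1
    exact pow_le_pow_left₀ (by positivity) (this.trans hIA) 2
  have hD1 : 1 ≤ (J + 5) * (J + 10) := by nlinarith
  have h2 : -(I * (I - c) / ((J + 5) * (J + 10))) ≤ c * (A * Nr) := by
    rw [← neg_div]
    rw [div_le_iff₀ (by positivity)]
    nlinarith [mul_nonneg hc hI0, mul_nonneg (mul_nonneg hc (hI0.trans hIA)) (by linarith : (0 : ℝ) ≤ (J + 5) * (J + 10) - 1)]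
  linarith

/-- `n/Q ≤ ⌊n/Q⌋ + 1`. [folklore] -/
private theorem div_le_natDiv_add_one' (n : ℕ) {Q : ℕ} (hQ : 0 < Q) : (n : ℝ) / (Q : ℝ) ≤ ((n / Q : ℕ) : ℝ) + 1 := by
  have h := Nat.lt_div_mul_add (a := n) (b := Q) hQ
  have hQ' : (0 : ℝ) < Q := by exact_mod_cast hQ
  rw [div_le_iff₀ hQ']
  have : (n : ℝ) ≤ ((n / Q : ℕ) : ℝ) * (Q : ℝ) + (Q : ℝ) := by exact_mod_cast h.le
  linarith

/-- The geometric factor beats cubes: `2^{-⌊N/Q⌋} N³ ≤ 96 Q³`. [folklore] -/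
private theorem half_pow_mul_cube_le {Q : ℕ} (hQ : 0 < Q) (N : ℕ) :
    (1 / 2 : ℝ) ^ (N / Q) * (N : ℝ) ^ 3 ≤ 96 * (Q : ℝ) ^ 3 := by
  rcases Nat.eq_zero_or_pos N with rfl | hN
  · simp
  have hQ' : (0 : ℝ) < Q := by exact_mod_cast hQ
  have hN' : (0 : ℝ) < N := by exact_mod_cast hN
  have hlog : (1 : ℝ) / 2 ≤ Real.log 2 := by
    have := Real.one_sub_inv_le_log_of_pos (show (0 : ℝ) < 2 by norm_num)
    norm_num at this ⊢; exact this
  have hlog0 : 0 < Real.log 2 := by linarith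
  set n := N / Q with hn
  set y : ℝ := (N : ℝ) * Real.log 2 / Q with hy
  have hy0 : 0 < y := by positivity
  -- `exp y ≤ 2^(n+1)`
  have h1 : Real.exp y ≤ (2 : ℝ) ^ (n + 1) := by
    have e : (2 : ℝ) ^ (n + 1) = Real.exp (((n + 1 : ℕ) : ℝ) * Real.log 2) := by
      rw [Real.exp_nat_mul, Real.exp_log two_pos]
    rw [e]
    apply Real.exp_le_exp.2
    have h2 := div_le_natDiv_add_one' N hQ
    rw [← hn] at h2
    have : y = (N : ℝ) / Q * Real.log 2 := by rw [hy]; ring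
    rw [this]; push_cast
    exact mul_le_mul_of_nonneg_right h2 hlog0.le
  -- `y³/6 ≤ exp y`
  have h3 : y ^ 3 / 6 ≤ Real.exp y := by
    have h := Real.sum_le_exp_of_nonneg hy0.le 4
    simp only [Finset.sum_range_succ, Finset.sum_range_zero, Nat.factorial, pow_zero, pow_one,
      Nat.cast_ofNat, zero_add, Nat.succ_eq_add_one, Nat.reduceAdd, Nat.reduceMul,
      Nat.cast_succ] at h
    nlinarith [h, hy0]
  -- `(1/2)^n N³ = 2 N³ / 2^(n+1) ≤ 2 N³ / exp y ≤ 12 N³ / y³ = 12 (Q/log 2)³`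
  have h4 : (1 / 2 : ℝ) ^ n = 2 / 2 ^ (n + 1) := by
    rw [one_div_pow, pow_succ]; field_simp
  have hexp : 0 < Real.exp y := Real.exp_pos y
  have h5 : (1 / 2 : ℝ) ^ n * (N : ℝ) ^ 3 ≤ 2 * (N : ℝ) ^ 3 / Real.exp y := by
    rw [h4, div_mul_eq_mul_div, le_div_iff₀ hexp]
    rw [div_mul_eq_mul_div, div_le_iff₀ (by positivity)]
    nlinarith [h1, pow_nonneg hN'.le 3]
  have h6 : 2 * (N : ℝ) ^ 3 / Real.exp y ≤ 12 * (N : ℝ) ^ 3 / y ^ 3 := by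
    rw [div_le_div_iff₀ hexp (by positivity)]
    nlinarith [h3, pow_nonneg hN'.le 3]
  have h7 : 12 * (N : ℝ) ^ 3 / y ^ 3 = 12 * (Q : ℝ) ^ 3 / Real.log 2 ^ 3 := by
    rw [hy]; field_simp
  have h8 : 12 * (Q : ℝ) ^ 3 / Real.log 2 ^ 3 ≤ 96 * (Q : ℝ) ^ 3 := by
    rw [div_le_iff₀ (by positivity)]
    have h9 : (1 / 2 : ℝ) ^ 3 ≤ Real.log 2 ^ 3 := pow_le_pow_left₀ (by norm_num) hlog 3
    have : (12 : ℝ) ≤ 96 * Real.log 2 ^ 3 := by norm_num at h9 ⊢; linarith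
    nlinarith [pow_nonneg hQ'.le 3]
  linarith [h5, h6, h7.le, h8]

/-- **The hairpin-sparsity input** in dimension `d+2` (shape of the lane's HP item = Madras–Slade Lemma 7.2.5
for the U-turn event): at most `C 2^{-⌊N/Q⌋} μ^N` of the `N`-step walks have at most `⌊N/(4Q)⌋` hairpins.
[cite: MadrasSlade1993, Lemma 7.2.5 (conclusion, for the U-turn event)] -/
def HairpinSparse (d Q : ℕ) (C : ℝ) : Prop :=
  ∀ N : ℕ, ((((saws (d + 2) N).filter fun ω => hcount N ω ≤ N / (4 * Q)).card : ℝ)) ≤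
    C * (1 / 2) ^ (N / Q) * connectiveConstant (d + 2) ^ N

/-- **Kesten's constant, explicit** (this file): with `A = 2(d+2)`, `c₀ = 10(d+2)`,
`B(d,Q,C) = 64000 A² Q³ + 64 c₀ A Q² + 96 C Q³ (A² + c₀ A) + 192 C A⁴ Q³ + 32 Q A⁴`.
[cite: MadrasSlade1993, Theorem 7.3.2, eq. (7.3.4) (the constant `D`, explicit form this file)] -/
def kestenB (d Q : ℕ) (C : ℝ) : ℝ :=
  64000 * (2 * ((d : ℝ) + 2)) ^ 2 * (Q : ℝ) ^ 3 + 64 * (10 * ((d : ℝ) + 2)) * (2 * ((d : ℝ) + 2)) * (Q : ℝ) ^ 2 +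
    96 * C * (Q : ℝ) ^ 3 * ((2 * ((d : ℝ) + 2)) ^ 2 + (10 * ((d : ℝ) + 2)) * (2 * ((d : ℝ) + 2))) +
    192 * C * (2 * ((d : ℝ) + 2)) ^ 4 * (Q : ℝ) ^ 3 + 32 * (Q : ℝ) * (2 * ((d : ℝ) + 2)) ^ 4

/-- `c_2 ≤ (2(d+2))²`. [folklore] -/
private theorem count_two_le_sq : (count (d + 2) 2 : ℝ) ≤ (2 * ((d : ℝ) + 2)) ^ 2 := by
  have h := count_succ_le (d + 2) 1
  have : (count (d + 2) 2 : ℝ) ≤ 2 * (d + 2) * (2 * (d + 2) - 1 : ℕ) := by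
    rw [pow_one] at h; exact_mod_cast h
  have h2 : ((2 * (d + 2) - 1 : ℕ) : ℝ) ≤ 2 * ((d : ℝ) + 2) := by
    have : 2 * (d + 2) - 1 ≤ 2 * (d + 2) := Nat.sub_le _ _
    exact_mod_cast this
  nlinarith [this, h2, (by positivity : (0 : ℝ) ≤ 2 * ((d : ℝ) + 2))]

/-- **Theorem 7.3.2 (a), explicit, from hairpin sparsity**: `φ_N² − B/N ≤ φ_N φ_{N+2}` for every `N ≥ 1`,
`φ_N = c_{N+2}/c_N`, `B = kestenB d Q C`. [cite: MadrasSlade1993, Theorem 7.3.2, eq. (7.3.4) (hairpin variant,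
quantitative form this file)] -/
theorem thm732_of_hairpinSparse {Q : ℕ} {C : ℝ} (hQ : 0 < Q) (hH : HairpinSparse d Q C) {N : ℕ}
    (hN : 1 ≤ N) :
    ((count (d + 2) (N + 2) : ℝ) / count (d + 2) N) ^ 2 - kestenB d Q C / N ≤
      ((count (d + 2) (N + 2) : ℝ) / count (d + 2) N) *
        ((count (d + 2) (N + 4) : ℝ) / count (d + 2) (N + 2)) := by
  classical
  have cpos : ∀ m, (0 : ℝ) < count (d + 2) m := fun m => by exact_mod_cast one_le_count (d + 2) m
  set A : ℝ := 2 * ((d : ℝ) + 2) with hA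
  set c : ℝ := 10 * ((d : ℝ) + 2) with hc
  have hd0 : (0 : ℝ) ≤ d := Nat.cast_nonneg d
  have hA0 : 0 < A := by rw [hA]; linarith
  have hA1 : 1 ≤ A := by rw [hA]; linarith
  have hc0 : 0 ≤ c := by rw [hc]; linarith
  set μ := connectiveConstant (d + 2) with hμ
  have hμ1 : 1 ≤ μ := one_le_connectiveConstant (d + 2)
  have hμ0 : 0 ≤ μ := by linarith
  have hμA : μ ≤ A := by
    have := connectiveConstant_le (d + 2) (by omega)
    rw [hA]; push_cast at this; linarith
  have hμN : ∀ n, μ ^ n ≤ count (d + 2) n := fun n => pow_connectiveConstant_le_count (d + 2) n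
  have hC0 : 0 ≤ C := by
    have h := hH 0
    simp only [Nat.zero_div, pow_zero, mul_one] at h
    exact le_trans (Nat.cast_nonneg _) h
  have hN0 : (0 : ℝ) < N := by exact_mod_cast hN
  have hN1 : (1 : ℝ) ≤ N := by exact_mod_cast hN
  have hQ0 : (0 : ℝ) < Q := by exact_mod_cast hQ
  set φ := (count (d + 2) (N + 2) : ℝ) / count (d + 2) N with hφ
  set φ' := (count (d + 2) (N + 4) : ℝ) / count (d + 2) (N + 2) with hφ'
  have hφ0 : 0 ≤ φ := div_nonneg (Nat.cast_nonneg _) (Nat.cast_nonneg _)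
  have hφ'0 : 0 ≤ φ' := div_nonneg (Nat.cast_nonneg _) (Nat.cast_nonneg _)
  have hφA : φ ≤ A ^ 2 := by
    rw [hφ, div_le_iff₀ (cpos N)]
    have h1 : (count (d + 2) (N + 2) : ℝ) ≤ count (d + 2) N * count (d + 2) 2 := by
      exact_mod_cast count_add_le (d + 2) N 2
    have h2 := count_two_le_sq (d := d)
    rw [← hA] at h2
    calc (count (d + 2) (N + 2) : ℝ) ≤ count (d + 2) N * count (d + 2) 2 := h1
      _ ≤ count (d + 2) N * A ^ 2 := mul_le_mul_of_nonneg_left h2 (cpos N).le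
      _ = A ^ 2 * count (d + 2) N := mul_comm _ _
  set B := kestenB d Q C with hB
  set X0 : ℝ := 64000 * A ^ 2 * Q ^ 3 + 64 * c * A * Q ^ 2 with hX0
  set K3 : ℝ := X0 + 96 * C * Q ^ 3 * (A ^ 2 + c * A) with hK3
  set K5 : ℝ := 96 * C * A ^ 2 * Q ^ 3 with hK5
  have hX0_0 : 0 ≤ X0 := by
    rw [hX0]
    have h1 := mul_nonneg (mul_nonneg (by norm_num : (0 : ℝ) ≤ 64000) (pow_nonneg hA0.le 2)) (pow_nonneg hQ0.le 3)
    have h2 := mul_nonneg (mul_nonneg (mul_nonneg (by norm_num : (0 : ℝ) ≤ 64) hc0) hA0.le) (pow_nonneg hQ0.le 2)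
    linarith
  have hAc : 0 ≤ A ^ 2 + c * A := add_nonneg (pow_nonneg hA0.le 2) (mul_nonneg hc0 hA0.le)
  have hK5_0 : 0 ≤ K5 := by
    rw [hK5]; exact mul_nonneg (mul_nonneg (mul_nonneg (by norm_num) hC0) (pow_nonneg hA0.le 2)) (pow_nonneg hQ0.le 3)
  have hCQ : 0 ≤ 96 * C * Q ^ 3 * (A ^ 2 + c * A) :=
    mul_nonneg (mul_nonneg (mul_nonneg (by norm_num : (0 : ℝ) ≤ 96) hC0) (pow_nonneg hQ0.le 3)) hAc
  have hK3_0 : 0 ≤ K3 := by rw [hK3]; linarith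
  have hA4 : 0 ≤ 32 * Q * A ^ 4 := mul_nonneg (mul_nonneg (by norm_num) hQ0.le) (pow_nonneg hA0.le 4)
  have hBdef : B = K3 + 2 * A ^ 2 * K5 + 32 * Q * A ^ 4 := by
    rw [hB, hK3, hK5, hX0]; unfold kestenB; rw [← hA, ← hc]; ring
  have hA2K5 : 0 ≤ 2 * A ^ 2 * K5 := mul_nonneg (mul_nonneg (by norm_num) (pow_nonneg hA0.le 2)) hK5_0
  have hB32 : 32 * Q * A ^ 4 ≤ B := by rw [hBdef]; linarith
  have hB35 : K3 + 2 * A ^ 2 * K5 ≤ B := by rw [hBdef]; linarith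
  have hφφ'0 : 0 ≤ φ * φ' := mul_nonneg hφ0 hφ'0
  -- small `N`: trivial
  by_cases hsmall : N < 32 * Q
  · have h1 : φ ^ 2 ≤ A ^ 4 := by
      have := pow_le_pow_left₀ hφ0 hφA 2
      calc φ ^ 2 ≤ (A ^ 2) ^ 2 := this
        _ = A ^ 4 := by ring
    have h2 : A ^ 4 ≤ B / N := by
      rw [le_div_iff₀ hN0]
      have : (N : ℝ) ≤ 32 * Q := by exact_mod_cast hsmall.le
      calc A ^ 4 * N ≤ A ^ 4 * (32 * Q) := mul_le_mul_of_nonneg_left this (pow_nonneg hA0.le 4)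
        _ = 32 * Q * A ^ 4 := by ring
        _ ≤ B := hB32
    linarith
  rw [not_lt] at hsmall
  have hNQ : 32 * (Q : ℝ) ≤ N := by exact_mod_cast hsmall
  -- the quantities
  set x : (ℕ → Site (d + 2)) → ℝ := fun ω => (ucount N ω : ℝ) / max ((hcount N ω : ℝ) - 3) 1 with hx
  set yv : (ℕ → Site (d + 2)) → ℝ := fun ω =>
    (ucount N ω : ℝ) * ((ucount N ω : ℝ) - c) / (((hcount N ω : ℝ) + 5) * ((hcount N ω : ℝ) + 10)) with hyv
  set T := ∑ ω ∈ saws (d + 2) N, x ω with hT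
  set Z : ℝ := (((saws (d + 2) (N + 2)).filter fun ω => hcount (N + 2) ω = 0).card : ℝ) with hZ
  have hx0 : ∀ ω, 0 ≤ x ω := fun ω => by
    rw [hx]; exact div_nonneg (Nat.cast_nonneg _) (le_trans zero_le_one (le_max_right _ _))
  have hT0 : 0 ≤ T := Finset.sum_nonneg fun ω _ => hx0 ω
  -- (K1)
  have hK1 : (count (d + 2) (N + 2) : ℝ) ≤ Z + T := count_add_two_le N
  -- (K2)
  have hK2 : ∑ ω ∈ saws (d + 2) N, yv ω ≤ count (d + 2) (N + 4) := by
    have := sum_le_count_add_four (d := d) N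
    rw [hyv, hc]; exact this
  -- Schwarz
  have hS : T ^ 2 ≤ count (d + 2) N * ∑ ω ∈ saws (d + 2) N, x ω ^ 2 := by
    rw [hT, ← card_saws]; exact sq_sum_le_card_mul_sum_sq
  -- the geometric factor
  have hgeo : (1 / 2 : ℝ) ^ (N / Q) * (N : ℝ) ^ 3 ≤ 96 * (Q : ℝ) ^ 3 := half_pow_mul_cube_le hQ N
  have hhalf0 : (0 : ℝ) ≤ (1 / 2 : ℝ) ^ (N / Q) := pow_nonneg (by norm_num) _
  have hN3 : (N : ℝ) ≤ (N : ℝ) ^ 3 := le_self_pow₀ hN1 (by norm_num)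
  have hN2 : (N : ℝ) ≤ (N : ℝ) ^ 2 := le_self_pow₀ hN1 (by norm_num)
  -- Ξ: pointwise
  have hxi : ∀ ω ∈ saws (d + 2) N, x ω ^ 2 - yv ω ≤
      if hcount N ω ≤ N / (4 * Q) then (A * N) ^ 2 + c * (A * N) else X0 / N := by
    intro ω _
    simp only [hx, hyv]
    have hI0 : (0 : ℝ) ≤ ucount N ω := Nat.cast_nonneg _
    have hIA : (ucount N ω : ℝ) ≤ A * N := by
      have := ucount_le N ω; rw [hA]; exact_mod_cast this
    have hJ0 : (0 : ℝ) ≤ hcount N ω := Nat.cast_nonneg _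
    have hm1 : (1 : ℝ) ≤ max ((hcount N ω : ℝ) - 3) 1 := le_max_right _ _
    split_ifs with hnear
    · exact xi_near hm1 hI0 hIA hc0 hJ0
    · -- far: `J ≥ N/(4Q)`, so `m = J - 3 ≥ N/(8Q)`
      rw [not_le] at hnear
      have hJ : (N : ℝ) / (4 * Q) ≤ hcount N ω := by
        have h1 := div_le_natDiv_add_one' N (Q := 4 * Q) (by omega)
        have h2 : ((N / (4 * Q) : ℕ) : ℝ) + 1 ≤ hcount N ω := by exact_mod_cast hnear
        push_cast at h1
        linarith
      have h8 : (8 : ℝ) ≤ (N : ℝ) / (4 * Q) := by rw [le_div_iff₀ (by positivity)]; linarith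
      have hm : max ((hcount N ω : ℝ) - 3) 1 = (hcount N ω : ℝ) - 3 := max_eq_left (by linarith)
      rw [hm]
      have hlam : (1 / (8 * (Q : ℝ))) * N ≤ (hcount N ω : ℝ) - 3 := by
        have e : (N : ℝ) / (4 * Q) = 2 * ((1 / (8 * (Q : ℝ))) * N) := by field_simp; ring
        have h3 : (3 : ℝ) ≤ (1 / (8 * (Q : ℝ))) * N := by linarith
        linarith
      have h := xi_far (I := (ucount N ω : ℝ)) (m := (hcount N ω : ℝ) - 3) (c := c) (A := A)
        (lam := 1 / (8 * (Q : ℝ))) (Nr := (N : ℝ)) (by linarith) (by positivity) hN0 hlam hI0 hIA hc0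
      have e1 : ((hcount N ω : ℝ) - 3 + 8) * ((hcount N ω : ℝ) - 3 + 13) =
          ((hcount N ω : ℝ) + 5) * ((hcount N ω : ℝ) + 10) := by ring
      rw [e1] at h
      have e2 : (125 * A ^ 2 / (1 / (8 * (Q : ℝ))) ^ 3 + c * A / (1 / (8 * (Q : ℝ))) ^ 2) = X0 := by
        rw [hX0]; field_simp; ring
      rw [e2] at h
      exact h
  -- Ξ: summed
  have hnear_card : ((((saws (d + 2) N).filter fun ω => hcount N ω ≤ N / (4 * Q)).card : ℝ)) ≤
      C * (1 / 2) ^ (N / Q) * μ ^ N := hH N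
  have hANc : 0 ≤ (A * N) ^ 2 + c * (A * N) :=
    add_nonneg (sq_nonneg _) (mul_nonneg hc0 (mul_nonneg hA0.le hN0.le))
  have hChalf : 0 ≤ C * (1 / 2 : ℝ) ^ (N / Q) := mul_nonneg hC0 hhalf0
  have hΞ : ∑ ω ∈ saws (d + 2) N, (x ω ^ 2 - yv ω) ≤ count (d + 2) N * (K3 / N) := by
    calc ∑ ω ∈ saws (d + 2) N, (x ω ^ 2 - yv ω)
        ≤ ∑ ω ∈ saws (d + 2) N, (if hcount N ω ≤ N / (4 * Q) then (A * N) ^ 2 + c * (A * N) else X0 / N) :=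
          Finset.sum_le_sum hxi
      _ = (((saws (d + 2) N).filter fun ω => hcount N ω ≤ N / (4 * Q)).card : ℝ) * ((A * N) ^ 2 + c * (A * N)) +
          (((saws (d + 2) N).filter fun ω => ¬ hcount N ω ≤ N / (4 * Q)).card : ℝ) * (X0 / N) := by
          rw [Finset.sum_ite, Finset.sum_const, Finset.sum_const, nsmul_eq_mul, nsmul_eq_mul]
      _ ≤ C * (1 / 2) ^ (N / Q) * μ ^ N * ((A * N) ^ 2 + c * (A * N)) + count (d + 2) N * (X0 / N) := by
          refine add_le_add (mul_le_mul_of_nonneg_right hnear_card hANc)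
            (mul_le_mul_of_nonneg_right ?_ (div_nonneg hX0_0 hN0.le))
          rw [← card_saws]; exact_mod_cast Finset.card_filter_le _ _
      _ ≤ count (d + 2) N * (96 * C * Q ^ 3 * (A ^ 2 + c * A) / N) + count (d + 2) N * (X0 / N) := by
          refine add_le_add ?_ le_rfl
          have h1 : (A * N) ^ 2 + c * (A * N) ≤ (A ^ 2 + c * A) * N ^ 2 := by
            have := mul_le_mul_of_nonneg_left hN2 (mul_nonneg hc0 hA0.le)
            calc (A * N) ^ 2 + c * (A * N) = A ^ 2 * N ^ 2 + c * A * N := by ring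
              _ ≤ A ^ 2 * N ^ 2 + c * A * N ^ 2 := by linarith
              _ = (A ^ 2 + c * A) * N ^ 2 := by ring
          have h2 : (1 / 2 : ℝ) ^ (N / Q) * (N : ℝ) ^ 2 ≤ 96 * (Q : ℝ) ^ 3 / N := by
            rw [le_div_iff₀ hN0]
            calc (1 / 2 : ℝ) ^ (N / Q) * (N : ℝ) ^ 2 * N = (1 / 2 : ℝ) ^ (N / Q) * (N : ℝ) ^ 3 := by ring
              _ ≤ _ := hgeo
          calc C * (1 / 2) ^ (N / Q) * μ ^ N * ((A * N) ^ 2 + c * (A * N))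
              ≤ C * (1 / 2) ^ (N / Q) * count (d + 2) N * ((A ^ 2 + c * A) * N ^ 2) :=
                mul_le_mul (mul_le_mul_of_nonneg_left (hμN N) hChalf) h1 hANc
                  (mul_nonneg hChalf (cpos N).le)
            _ = C * count (d + 2) N * (A ^ 2 + c * A) * ((1 / 2 : ℝ) ^ (N / Q) * (N : ℝ) ^ 2) := by ring
            _ ≤ C * count (d + 2) N * (A ^ 2 + c * A) * (96 * (Q : ℝ) ^ 3 / N) :=
                mul_le_mul_of_nonneg_left h2 (mul_nonneg (mul_nonneg hC0 (cpos N).le) hAc)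
            _ = count (d + 2) N * (96 * C * Q ^ 3 * (A ^ 2 + c * A) / N) := by ring
      _ = count (d + 2) N * (K3 / N) := by rw [hK3]; ring
  -- hence `Σ x² ≤ c_{N+4} + c_N K3/N`
  have hsumsq : ∑ ω ∈ saws (d + 2) N, x ω ^ 2 ≤ count (d + 2) (N + 4) + count (d + 2) N * (K3 / N) := by
    have : ∑ ω ∈ saws (d + 2) N, x ω ^ 2 =
        ∑ ω ∈ saws (d + 2) N, yv ω + ∑ ω ∈ saws (d + 2) N, (x ω ^ 2 - yv ω) := by
      rw [← Finset.sum_add_distrib]; exact Finset.sum_congr rfl fun ω _ => by ring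
    rw [this]; linarith [hK2, hΞ]
  -- `Z ≤ K5 c_N / N`
  have hZle : Z ≤ K5 / N * count (d + 2) N := by
    have h1 : Z ≤ (((saws (d + 2) (N + 2)).filter fun ω => hcount (N + 2) ω ≤ (N + 2) / (4 * Q)).card : ℝ) := by
      rw [hZ]
      exact_mod_cast Finset.card_le_card fun ω hω => by
        rw [Finset.mem_filter] at hω ⊢
        exact ⟨hω.1, by rw [hω.2]; exact Nat.zero_le _⟩
    have h2 := hH (N + 2)
    have h3 : (1 / 2 : ℝ) ^ ((N + 2) / Q) ≤ (1 / 2 : ℝ) ^ (N / Q) :=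
      pow_le_pow_of_le_one (by norm_num) (by norm_num) (Nat.div_le_div_right (by omega))
    have h4 : μ ^ (N + 2) ≤ A ^ 2 * count (d + 2) N := by
      rw [pow_add]
      calc μ ^ N * μ ^ 2 ≤ count (d + 2) N * A ^ 2 :=
            mul_le_mul (hμN N) (pow_le_pow_left₀ hμ0 hμA 2) (pow_nonneg hμ0 2) (cpos N).le
        _ = _ := by ring
    have h5 : (1 / 2 : ℝ) ^ (N / Q) ≤ 96 * (Q : ℝ) ^ 3 / N := by
      rw [le_div_iff₀ hN0]
      calc (1 / 2 : ℝ) ^ (N / Q) * N ≤ (1 / 2 : ℝ) ^ (N / Q) * (N : ℝ) ^ 3 := mul_le_mul_of_nonneg_left hN3 hhalf0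
        _ ≤ _ := hgeo
    calc Z ≤ C * (1 / 2) ^ ((N + 2) / Q) * μ ^ (N + 2) := h1.trans h2
      _ ≤ C * (1 / 2) ^ (N / Q) * (A ^ 2 * count (d + 2) N) :=
          mul_le_mul (mul_le_mul_of_nonneg_left h3 hC0) h4 (pow_nonneg hμ0 _) hChalf
      _ = C * A ^ 2 * count (d + 2) N * (1 / 2 : ℝ) ^ (N / Q) := by ring
      _ ≤ C * A ^ 2 * count (d + 2) N * (96 * (Q : ℝ) ^ 3 / N) :=
          mul_le_mul_of_nonneg_left h5 (mul_nonneg (mul_nonneg hC0 (pow_nonneg hA0.le 2)) (cpos N).le)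
      _ = K5 / N * count (d + 2) N := by rw [hK5]; ring
  -- the final algebra
  set z := Z / count (d + 2) N with hz
  set t := T / count (d + 2) N with ht
  have hZ0 : 0 ≤ Z := by rw [hZ]; exact Nat.cast_nonneg _
  have hz0 : 0 ≤ z := div_nonneg hZ0 (cpos N).le
  have hzle : z ≤ K5 / N := by rw [hz, div_le_iff₀ (cpos N)]; exact hZle
  have ht0 : 0 ≤ t := div_nonneg hT0 (cpos N).le
  have hφzt : φ ≤ z + t := by
    rw [hφ, hz, ht, ← add_div, div_le_div_iff_of_pos_right (cpos N)]; exact hK1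
  have hφφ' : φ * φ' = (count (d + 2) (N + 4) : ℝ) / count (d + 2) N := by
    rw [hφ, hφ', div_mul_div_comm, mul_comm (count (d + 2) (N + 2) : ℝ),
      mul_div_mul_right _ _ (cpos (N + 2)).ne']
  have ht2 : t ^ 2 ≤ φ * φ' + K3 / N := by
    have h1 : t ^ 2 = T ^ 2 / (count (d + 2) N) ^ 2 := by rw [ht, div_pow]
    have h2 : T ^ 2 / (count (d + 2) N : ℝ) ^ 2 ≤
        (count (d + 2) N * (count (d + 2) (N + 4) + count (d + 2) N * (K3 / N))) / (count (d + 2) N : ℝ) ^ 2 :=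
      div_le_div_of_nonneg_right (hS.trans (mul_le_mul_of_nonneg_left hsumsq (cpos N).le)) (sq_nonneg _)
    have h3 : (count (d + 2) N * (count (d + 2) (N + 4) + count (d + 2) N * (K3 / N))) / (count (d + 2) N : ℝ) ^ 2 =
        (count (d + 2) (N + 4) : ℝ) / count (d + 2) N + K3 / N := by
      have := (cpos N).ne'
      have := hN0.ne'
      field_simp
    rw [hφφ', h1]
    linarith [h2, h3.le, h3.ge]
  rcases le_or_gt φ z with hle | hgt
  · -- `φ ≤ z`: `φ² ≤ φ z ≤ A² K5/N ≤ B/N`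
    have h1 : φ ^ 2 ≤ K5 / N * A ^ 2 := by
      calc φ ^ 2 = φ * φ := sq φ
        _ ≤ z * φ := mul_le_mul_of_nonneg_right hle hφ0
        _ ≤ K5 / N * A ^ 2 := mul_le_mul hzle hφA hφ0 (div_nonneg hK5_0 hN0.le)
    have h2 : K5 / N * A ^ 2 ≤ B / N := by
      rw [div_mul_eq_mul_div]
      have e : 2 * A ^ 2 * K5 = 2 * (K5 * A ^ 2) := by ring
      have h0 : 0 ≤ K5 * A ^ 2 := mul_nonneg hK5_0 (pow_nonneg hA0.le 2)
      exact div_le_div_of_nonneg_right (by linarith [hB35, hK3_0]) hN0.le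
    linarith
  · have h1 : (φ - z) ^ 2 ≤ t ^ 2 := pow_le_pow_left₀ (by linarith) (by linarith) 2
    have e : (φ - z) ^ 2 = φ ^ 2 - 2 * (φ * z) + z ^ 2 := by ring
    have h3 : φ * z ≤ A ^ 2 * (K5 / N) := mul_le_mul hφA hzle hz0 (pow_nonneg hA0.le 2)
    have h4 : K3 / N + 2 * (A ^ 2 * (K5 / N)) ≤ B / N := by
      rw [show K3 / N + 2 * (A ^ 2 * (K5 / N)) = (K3 + 2 * A ^ 2 * K5) / N by ring]
      exact div_le_div_of_nonneg_right hB35 hN0.le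
    linarith [h1, e, ht2, h3, h4, sq_nonneg z]

end Assembly

/-! ### (7.3.3) and the explicit ratio rate (with `KestenRate.upper_dev` / `lower_dev`) -/

section Rate

open KestenRate

/-- **(7.3.3), explicit, from hairpin sparsity**: `c_{n+2}/c_n − B/n ≤ c_{n+4}/c_{n+2}` for every `n ≥ 1`
(from (7.3.4), since `c_{n+2}/c_n ≥ 1`) — the hypothesis `hK` of `KestenRate.upper_dev`/`lower_dev`.
[cite: MadrasSlade1993, Lemma 7.3.1, eq. (7.3.3) (hairpin variant, explicit constant this file)] -/
theorem kesten733_of_hairpinSparse {Q : ℕ} {C : ℝ} (hQ : 0 < Q) (hH : HairpinSparse d Q C) {n : ℕ}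
    (hn : 1 ≤ n) :
    (count (d + 2) (n + 2) : ℝ) / count (d + 2) n - kestenB d Q C / n ≤
      (count (d + 2) (n + 4) : ℝ) / count (d + 2) (n + 2) := by
  have hcpos : ∀ m, (0 : ℝ) < count (d + 2) m := fun m => by exact_mod_cast one_le_count (d + 2) m
  have h := thm732_of_hairpinSparse hQ hH hn
  set φ := (count (d + 2) (n + 2) : ℝ) / count (d + 2) n with hφ
  set φ' := (count (d + 2) (n + 4) : ℝ) / count (d + 2) (n + 2) with hφ'
  have hφ1 : 1 ≤ φ := by
    rw [hφ, le_div_iff₀ (hcpos n), one_mul]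
    exact_mod_cast count_le_count_add_two (d + 2) n
  have hC0 : 0 ≤ C := by
    have h := hH 0
    simp only [Nat.zero_div, pow_zero, mul_one] at h
    exact le_trans (Nat.cast_nonneg _) h
  have hd0 : (0 : ℝ) ≤ d := Nat.cast_nonneg d
  have hQ0 : (0 : ℝ) ≤ Q := Nat.cast_nonneg Q
  have hD0 : 0 ≤ kestenB d Q C := by unfold kestenB; positivity
  have hn0 : (0 : ℝ) < n := by exact_mod_cast hn
  have hφ0 : 0 < φ := by linarith
  have h1 : φ - kestenB d Q C / (n * φ) ≤ φ' := by
    have e : φ - kestenB d Q C / (n * φ) = (φ ^ 2 - kestenB d Q C / n) / φ := by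
      field_simp
    rw [e, div_le_iff₀ hφ0]
    nlinarith
  have h2 : kestenB d Q C / (n * φ) ≤ kestenB d Q C / n := by
    rw [mul_comm]
    exact div_le_div_of_nonneg_left hD0 hn0 (by nlinarith)
  linarith

/-- The envelope is non-negative (`μ ≥ 1`). [folklore] -/
private theorem hwEnvelope_nonneg' {μ : ℝ} (hμ : 1 ≤ μ) (n : ℕ) : 0 ≤ hwEnvelope μ n := by
  unfold hwEnvelope
  have h1 : 0 ≤ Real.log ((n : ℝ) + 1) := Real.log_nonneg (by have := Nat.cast_nonneg (α := ℝ) n; linarith)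
  have h2 : 0 ≤ Real.log μ := Real.log_nonneg hμ
  positivity

/-- The envelope is monotone in `n`. [folklore] -/
private theorem hwEnvelope_mono' {μ : ℝ} {n m : ℕ} (hnm : n ≤ m) : hwEnvelope μ n ≤ hwEnvelope μ m := by
  unfold hwEnvelope
  have hnm' : (n : ℝ) ≤ m := by exact_mod_cast hnm
  have h1 : Real.log ((n : ℝ) + 1) ≤ Real.log ((m : ℝ) + 1) :=
    Real.log_le_log (by positivity) (by linarith)
  have h2 : Real.sqrt (2 * ((n : ℝ) + 1) / 3) ≤ Real.sqrt (2 * ((m : ℝ) + 1) / 3) :=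
    Real.sqrt_le_sqrt (by linarith)
  nlinarith [Real.pi_pos]

/-- `log(1 + x) ≥ x/3` on `[0, 2]`. [folklore] -/
private theorem log_one_add_ge' {x : ℝ} (hx0 : 0 ≤ x) (hx2 : x ≤ 2) : x / 3 ≤ Real.log (1 + x) := by
  have h := Real.one_sub_inv_le_log_of_pos (show 0 < 1 + x by linarith)
  have e : 1 - (1 + x)⁻¹ = x / (1 + x) := by field_simp; ring
  rw [e] at h
  have h2 : x / 3 ≤ x / (1 + x) := div_le_div_of_nonneg_left hx0 (by linarith) (by linarith)
  linarith

/-- `−log(1 − x) ≥ x` for `x < 1`. [folklore] -/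
private theorem neg_log_one_sub_ge' {x : ℝ} (hx : x < 1) : x ≤ -Real.log (1 - x) := by
  have h := Real.log_le_sub_one_of_pos (show 0 < 1 - x by linarith)
  linarith

/-- From `(uN/(kB) − 1)(u/(lμ²)) ≤ G` to `u² N ≤ k l B μ² G + k B u`. [folklore] -/
private theorem sq_mul_le_of' {u N B μ G k l : ℝ} (hB : 0 < B) (hμ : 0 < μ) (hk : 0 < k) (hl : 0 < l)
    (h : (u * N / (k * B) - 1) * (u / (l * μ ^ 2)) ≤ G) :
    u ^ 2 * N ≤ k * l * B * μ ^ 2 * G + k * B * u := by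
  have hden : 0 < k * B * (l * μ ^ 2) := by positivity
  have e : (u * N / (k * B) - 1) * (u / (l * μ ^ 2)) = (u ^ 2 * N - k * B * u) / (k * B * (l * μ ^ 2)) := by
    field_simp
  rw [e, div_le_iff₀ hden] at h
  nlinarith

/-- **Explicit Kesten ratio rate from Kesten's inequality, every dimension** (the assembly of lane item X24 with
the inequality as a hypothesis): if `c_{n+2}/c_n − B₀/n ≤ c_{n+4}/c_{n+2}` for all `n ≥ 1` then, for every
`N ≥ 1`, `|c_{N+2}/c_N − μ²| ≤ μ √(12 (B₀ + (2(d+2))²) (G(2N) + 1)/N)` with the Hammersley–Welsh envelope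
`G = hwEnvelope μ` — a rate `O(N^{-1/4})` with the constant in closed form (printed: Kesten 1963, exponent `1/3`,
constant inexplicit). [cite: MadrasSlade1993, §7.5, eq. (7.5.1) and Lemma 7.3.1 / Theorem 7.3.2 (quantitative
form, this file)] -/
theorem ratioRate_of_kestenIneq (d : ℕ) {B₀ : ℝ} (hB₀ : 0 ≤ B₀)
    (hK₀ : ∀ n : ℕ, 1 ≤ n → (count (d + 2) (n + 2) : ℝ) / count (d + 2) n - B₀ / n ≤
      (count (d + 2) (n + 4) : ℝ) / count (d + 2) (n + 2))
    {N : ℕ} (hN : 1 ≤ N) :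
    |(count (d + 2) (N + 2) : ℝ) / count (d + 2) N - connectiveConstant (d + 2) ^ 2| ≤
      connectiveConstant (d + 2) *
        Real.sqrt (12 * (B₀ + (2 * ((d : ℝ) + 2)) ^ 2) *
          (hwEnvelope (connectiveConstant (d + 2)) (2 * N) + 1) / N) := by
  -- the data
  set μ := connectiveConstant (d + 2) with hμdef
  set c : ℕ → ℝ := fun n => (count (d + 2) n : ℝ) with hcdef
  set A : ℝ := 2 * ((d : ℝ) + 2) with hA
  set B := B₀ + A ^ 2 with hBdef
  set G : ℕ → ℝ := hwEnvelope μ with hGdef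
  have hc : ∀ n, 0 < c n := fun n => by simp only [hcdef]; exact_mod_cast one_le_count (d + 2) n
  have hd0 : (0 : ℝ) ≤ d := Nat.cast_nonneg d
  have hμd : (d : ℝ) + 2 ≤ μ := by
    have := BDGS2012_count_bounds_holds.le_connectiveConstant (d + 2); push_cast at this; simpa using this
  have hμ2 : 2 ≤ μ := by linarith
  have hμA : μ ≤ A := by
    have := connectiveConstant_le (d + 2) (by omega); rw [hA]; push_cast at this; linarith
  have hμ : 0 < μ := by linarith
  have hμ1 : 1 ≤ μ := by linarith
  have hA0 : 0 < A := by rw [hA]; linarith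
  have hμsq : ((d : ℝ) + 2) ^ 2 ≤ μ ^ 2 := pow_le_pow_left₀ (by linarith) hμd 2
  have hA2 : A ^ 2 = 4 * ((d : ℝ) + 2) ^ 2 := by rw [hA]; ring
  have hμ4 : 4 ≤ μ ^ 2 := by
    have := pow_le_pow_left₀ (by norm_num : (0:ℝ) ≤ 2) hμ2 2; norm_num at this; linarith
  have hB0 : 0 < B := by rw [hBdef]; positivity
  have hBA : A ^ 2 ≤ B := by rw [hBdef]; linarith
  have hN0 : (0 : ℝ) < N := by exact_mod_cast hN
  -- (7.3.3) with `B`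
  have hK : ∀ n : ℕ, 1 ≤ n → c (n + 2) / c n - B / n ≤ c (n + 4) / c (n + 2) := by
    intro n hn
    have h := hK₀ n hn
    have hn0 : (0 : ℝ) < n := by exact_mod_cast hn
    have : B₀ / (n : ℝ) ≤ B / n :=
      div_le_div_of_nonneg_right (by have := sq_nonneg A; linarith) hn0.le
    simp only [hcdef]
    linarith
  have hlo : ∀ n, μ ^ n ≤ c n := fun n => pow_connectiveConstant_le_count (d + 2) n
  have hhi : ∀ n, c n ≤ Real.exp (G n) * μ ^ n := fun n => count_le_envelope (d + 2) n
  have hG0 : 0 ≤ G (2 * N) := hwEnvelope_nonneg' hμ1 _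
  -- `φ_N ≤ A²`
  set φ := c (N + 2) / c N with hφdef
  have hφA : φ ≤ A ^ 2 := by
    rw [hφdef, div_le_iff₀ (hc N)]
    have h1 : (count (d + 2) (N + 2) : ℝ) ≤ count (d + 2) N * count (d + 2) 2 := by
      exact_mod_cast count_add_le (d + 2) N 2
    have h2 := count_two_le_sq (d := d)
    rw [← hA] at h2
    simp only [hcdef]
    calc (count (d + 2) (N + 2) : ℝ) ≤ count (d + 2) N * count (d + 2) 2 := h1
      _ ≤ count (d + 2) N * A ^ 2 := mul_le_mul_of_nonneg_left h2 (Nat.cast_nonneg _)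
      _ = A ^ 2 * count (d + 2) N := mul_comm _ _
  have hφ1 : 1 ≤ φ := by
    rw [hφdef, le_div_iff₀ (hc N), one_mul]; simp only [hcdef]
    exact_mod_cast count_le_count_add_two (d + 2) N
  -- the target quantity
  set R := μ * Real.sqrt (12 * B * (G (2 * N) + 1) / N) with hRdef
  have hR_of_sq : ∀ u : ℝ, 0 ≤ u → u ^ 2 * N ≤ 12 * B * μ ^ 2 * (G (2 * N) + 1) → u ≤ R := by
    intro u hu0 h
    rw [hRdef]
    have e : μ * Real.sqrt (12 * B * (G (2 * N) + 1) / N) =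
        Real.sqrt (μ ^ 2 * (12 * B * (G (2 * N) + 1) / N)) := by
      rw [Real.sqrt_mul' _ (by positivity), Real.sqrt_sq hμ.le]
    rw [e, Real.le_sqrt hu0 (by positivity), ← mul_div_assoc, le_div_iff₀ hN0]
    linarith [h]
  show |φ - μ ^ 2| ≤ R
  rcases lt_trichotomy φ (μ ^ 2) with hlt | heq | hgt
  · -- lower deviation
    set u := μ ^ 2 - φ with hudef
    have hu : 0 < u := by rw [hudef]; linarith
    have huB : u ≤ B := by
      have := pow_le_pow_left₀ hμ.le hμA 2; rw [hudef]; linarith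
    rw [abs_sub_comm, abs_of_pos (by linarith : 0 < μ ^ 2 - φ)]
    set M := ⌊u * N / (4 * B)⌋₊ with hMdef
    have hMle : (M : ℝ) ≤ u * N / (4 * B) := Nat.floor_le (by positivity)
    have hMge : u * N / (4 * B) - 1 ≤ M := by
      have := Nat.lt_floor_add_one (u * N / (4 * B)); rw [← hMdef] at this; linarith
    have h4M : 4 * (M : ℝ) ≤ N := by
      have : u * N / (4 * B) ≤ N / 4 := by
        rw [div_le_div_iff₀ (by positivity) (by norm_num)]
        have := mul_le_mul_of_nonneg_left huB (show (0:ℝ) ≤ 4 * N by positivity)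
        linarith
      linarith
    have h4Mn : 4 * M ≤ N := by exact_mod_cast h4M
    set N' := N - 2 * M with hN'def
    have hN'1 : 1 ≤ N' := by omega
    have h2M : 2 * M ≤ N' := by omega
    have hNN : N' + 2 * M = N := by omega
    have hdev : c (N' + 2 * M + 2) / c (N' + 2 * M) ≤ μ ^ 2 - u := by rw [hNN, ← hφdef, hudef]; linarith
    have hM4 : 4 * (M : ℝ) * B ≤ u * ((N' : ℝ) + 2 * M) := by
      have e : ((N' : ℝ) + 2 * M) = N := by exact_mod_cast hNN
      rw [e]
      have := mul_le_mul_of_nonneg_right hMle (show (0:ℝ) ≤ 4 * B by positivity)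
      rw [div_mul_cancel₀ _ (by positivity)] at this
      linarith
    have hld := lower_dev hc hμ hB0.le hK hlo hhi hN'1 h2M hu hdev hM4
    have hx1 : u / (2 * μ ^ 2) < 1 := by rw [div_lt_one (by positivity)]; rw [hudef]; linarith
    have hx0 : 0 ≤ u / (2 * μ ^ 2) := by positivity
    have hlog := neg_log_one_sub_ge' hx1
    have hGmono : G N' ≤ G (2 * N) := hwEnvelope_mono' (by omega)
    have h1 : (M : ℝ) * (u / (2 * μ ^ 2)) ≤ G (2 * N) := by
      have := mul_le_mul_of_nonneg_left hlog (Nat.cast_nonneg M)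
      linarith
    have h2 : (u * N / (4 * B) - 1) * (u / (2 * μ ^ 2)) ≤ G (2 * N) := by
      rcases le_or_gt 0 (u * N / (4 * B) - 1) with hpos | hneg
      · exact (mul_le_mul_of_nonneg_right hMge hx0).trans h1
      · exact (mul_nonpos_of_nonpos_of_nonneg hneg.le hx0).trans hG0
    have h3 := sq_mul_le_of' hB0 hμ (by norm_num : (0:ℝ) < 4) (by norm_num : (0:ℝ) < 2) h2
    refine hR_of_sq u hu.le ?_
    have h4 : B * u ≤ B * (3 * μ ^ 2) := mul_le_mul_of_nonneg_left (by rw [hudef]; linarith) hB0.le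
    have h5 : 0 ≤ B * μ ^ 2 * G (2 * N) := by positivity
    have e3 : (4 : ℝ) * 2 * B * μ ^ 2 * G (2 * N) + 4 * B * u = 8 * (B * μ ^ 2 * G (2 * N)) + 4 * (B * u) := by ring
    have e4 : (12 : ℝ) * B * μ ^ 2 * (G (2 * N) + 1) = 12 * (B * μ ^ 2 * G (2 * N)) + 4 * (B * (3 * μ ^ 2)) := by ring
    rw [e3] at h3; rw [e4]
    linarith
  · rw [heq, sub_self, abs_zero]; positivity
  · -- upper deviation
    set u := φ - μ ^ 2 with hudef
    have hu : 0 < u := by rw [hudef]; linarith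
    have hμ0' : 0 ≤ μ ^ 2 := by positivity
    have huA : u ≤ A ^ 2 := by rw [hudef]; linarith
    rw [abs_of_pos (by linarith : 0 < φ - μ ^ 2)]
    set M := ⌊u * N / (2 * B)⌋₊ with hMdef
    have hMle : (M : ℝ) ≤ u * N / (2 * B) := Nat.floor_le (by positivity)
    have hMge : u * N / (2 * B) - 1 ≤ M := by
      have := Nat.lt_floor_add_one (u * N / (2 * B)); rw [← hMdef] at this; linarith
    have h2M : 2 * (M : ℝ) ≤ N := by
      have : u * N / (2 * B) ≤ N / 2 := by
        rw [div_le_div_iff₀ (by positivity) (by norm_num)]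
        have := mul_le_mul_of_nonneg_left (huA.trans hBA) (show (0:ℝ) ≤ 2 * N by positivity)
        linarith
      linarith
    have h2Mn : 2 * M ≤ N := by exact_mod_cast h2M
    have hdev : μ ^ 2 + u ≤ c (N + 2) / c N := by rw [← hφdef, hudef]; linarith
    have hMB : (M : ℝ) * B ≤ u * N / 2 := by
      have h1 := mul_le_mul_of_nonneg_right hMle hB0.le
      have e : u * N / (2 * B) * B = u * N / 2 := by field_simp
      rw [e] at h1; exact h1
    have hud := upper_dev hc hμ hB0.le hK hlo hhi hN hu hdev hMB
    have hx0 : 0 ≤ u / (2 * μ ^ 2) := by positivity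
    have hx2 : u / (2 * μ ^ 2) ≤ 2 := by
      rw [div_le_iff₀ (by positivity)]; linarith [huA, hA2, hμsq]
    have hlog := log_one_add_ge' hx0 hx2
    have hGmono : G (N + 2 * M) ≤ G (2 * N) := hwEnvelope_mono' (by omega)
    have h1 : (M : ℝ) * (u / (2 * μ ^ 2) / 3) ≤ G (2 * N) := by
      have := mul_le_mul_of_nonneg_left hlog (Nat.cast_nonneg M)
      linarith
    have h2 : (u * N / (2 * B) - 1) * (u / (6 * μ ^ 2)) ≤ G (2 * N) := by
      have e : u / (6 * μ ^ 2) = u / (2 * μ ^ 2) / 3 := by field_simp; ring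
      rw [e]
      rcases le_or_gt 0 (u * N / (2 * B) - 1) with hpos | hneg
      · exact (mul_le_mul_of_nonneg_right hMge (by positivity)).trans h1
      · exact (mul_nonpos_of_nonpos_of_nonneg hneg.le (by positivity)).trans hG0
    have h3 := sq_mul_le_of' hB0 hμ (by norm_num : (0:ℝ) < 2) (by norm_num : (0:ℝ) < 6) h2
    refine hR_of_sq u hu.le ?_
    have h4 : B * u ≤ B * (6 * μ ^ 2) := mul_le_mul_of_nonneg_left (by linarith [huA, hA2, hμsq]) hB0.le
    have h5 : 0 ≤ B * μ ^ 2 * G (2 * N) := by positivity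
    have e3 : (2 : ℝ) * 6 * B * μ ^ 2 * G (2 * N) + 2 * B * u = 12 * (B * μ ^ 2 * G (2 * N)) + 2 * (B * u) := by ring
    have e4 : (12 : ℝ) * B * μ ^ 2 * (G (2 * N) + 1) = 12 * (B * μ ^ 2 * G (2 * N)) + 2 * (B * (6 * μ ^ 2)) := by ring
    rw [e3] at h3; rw [e4]
    linarith

/-- **Explicit Kesten ratio rate from hairpin sparsity, every dimension** (KR-3): under `HairpinSparse d Q C`,
`|c_{N+2}/c_N − μ²| ≤ μ √(12 (kestenB d Q C + (2(d+2))²) (G(2N) + 1)/N)` for every `N ≥ 1`.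
[cite: MadrasSlade1993, §7.5, eq. (7.5.1) (Kesten 1963; quantitative form from the hairpin density, this file)] -/
theorem ratioRate_of_hairpinSparse {Q : ℕ} {C : ℝ} (hQ : 0 < Q) (hH : HairpinSparse d Q C) {N : ℕ}
    (hN : 1 ≤ N) :
    |(count (d + 2) (N + 2) : ℝ) / count (d + 2) N - connectiveConstant (d + 2) ^ 2| ≤
      connectiveConstant (d + 2) *
        Real.sqrt (12 * (kestenB d Q C + (2 * ((d : ℝ) + 2)) ^ 2) *
          (hwEnvelope (connectiveConstant (d + 2)) (2 * N) + 1) / N) := by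
  have hC0 : 0 ≤ C := by
    have h := hH 0
    simp only [Nat.zero_div, pow_zero, mul_one] at h
    exact le_trans (Nat.cast_nonneg _) h
  have hd0 : (0 : ℝ) ≤ d := Nat.cast_nonneg d
  have hQ0 : (0 : ℝ) ≤ Q := Nat.cast_nonneg Q
  have hB0 : 0 ≤ kestenB d Q C := by unfold kestenB; positivity
  exact ratioRate_of_kestenIneq d hB0 (fun n hn => kesten733_of_hairpinSparse hQ hH hn) hN

/-! ### The planar case in the lane's typed shapes -/

/-- The lane's `KestenIneqZ2 B` (seat a-idea-2, Sketch_v5 §25): Kesten's (7.3.3) on `ℤ²` with constant `B`.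
[cite: MadrasSlade1993, Lemma 7.3.1, eq. (7.3.3)] -/
def KestenIneqZ2 (B : ℝ) : Prop :=
  ∀ n : ℕ, 1 ≤ n →
    (count 2 (n + 2) : ℝ) / count 2 n - B / n ≤ (count 2 (n + 4) : ℝ) / count 2 (n + 2)

/-- **KR-1 on `ℤ²`**: hairpin sparsity with parameters `(Q, C)` gives `KestenIneqZ2 (kestenB 0 Q C)`, i.e.
Kesten's inequality with an explicit constant (`kestenB 0 Q C = 4 096 000 Q³ + 20 480 Q² + 9 216 C Q³ +
49 152 C Q³ + 8 192 Q`). [cite: MadrasSlade1993, Theorem 7.3.2 (a) and eq. (7.3.3) (hairpin variant, explicit,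
this file)] -/
theorem kestenIneqZ2_of_hairpinSparse {Q : ℕ} {C : ℝ} (hQ : 0 < Q) (hH : HairpinSparse 0 Q C) :
    KestenIneqZ2 (kestenB 0 Q C) := fun _ hn => kesten733_of_hairpinSparse hQ hH hn

/-- **KR-3 on `ℤ²`** in the lane's typed shape `KestenRatioRateZ2` (`∃ K, ∀ N ≥ 1, |c_{N+2}/c_N − μ²| ≤
K √((G(2N)+1)/N)`), with the witness `K = μ √(12 (kestenB 0 Q C + 16))`.
[cite: MadrasSlade1993, §7.5, eq. (7.5.1) (quantitative form, this file)] -/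
theorem kestenRatioRateZ2_of_hairpinSparse {Q : ℕ} {C : ℝ} (hQ : 0 < Q) (hH : HairpinSparse 0 Q C) :
    ∃ K : ℝ, ∀ N : ℕ, 1 ≤ N →
      |(count 2 (N + 2) : ℝ) / count 2 N - connectiveConstant 2 ^ 2| ≤
        K * Real.sqrt ((hwEnvelope (connectiveConstant 2) (2 * N) + 1) / N) := by
  have hC0 : 0 ≤ C := by
    have h := hH 0
    simp only [Nat.zero_div, pow_zero, mul_one] at h
    exact le_trans (Nat.cast_nonneg _) h
  have hQ0 : (0 : ℝ) ≤ Q := Nat.cast_nonneg Q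
  have hB0 : 0 ≤ kestenB 0 Q C := by unfold kestenB; positivity
  refine ⟨connectiveConstant 2 * Real.sqrt (12 * (kestenB 0 Q C + 16)), fun N hN => ?_⟩
  have h := ratioRate_of_hairpinSparse (d := 0) hQ hH hN
  have e2 : (2 * (((0 : ℕ) : ℝ) + 2)) ^ 2 = 16 := by norm_num
  rw [e2] at h
  have e3 : 12 * (kestenB 0 Q C + 16) * (hwEnvelope (connectiveConstant (0 + 2)) (2 * N) + 1) / N =
      (12 * (kestenB 0 Q C + 16)) * ((hwEnvelope (connectiveConstant (0 + 2)) (2 * N) + 1) / N) := by ring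
  rw [e3, Real.sqrt_mul (by positivity), ← mul_assoc] at h
  exact h

end Rate

/-! ## Families closed under the swap: vertex-hereditary fixed-endpoint families (for bridges: KR-BR)

For a predicate `P s e v` on (start, endpoint, vertex), the family `W_N = {ω ∈ S_N : ∀ 1 ≤ i ≤ N, P(ω 0, ω N, ω i)}`
(bridges: `P s e v := s₀ < v₀ ∧ v₀ ≤ e₀`) is closed under contraction of hairpins (vertices are deleted, the
endpoint is kept) and under the swap at those U-occurrences whose two new sites satisfy `P` ("U_W-occurrences");
the double counting and the local bounds of the walk case go through word for word, and Kesten's inequality follows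
from two RELATIVE sparsity hypotheses (lane seat a-idea-2, ROUTES §25.16–25.22); the instance `W = bridges` on `ℤ²`
with all constants explicit is `SAWKestenBridgesZ2.lean`. -/

section Family

variable (P : Site (d + 2) → Site (d + 2) → Site (d + 2) → Prop)

/-- The membership condition of the family: every vertex `ω i`, `1 ≤ i ≤ n`, satisfies `P (ω 0) (ω n) ·`
(bridges: `P s e v := s₀ < v₀ ∧ v₀ ≤ e₀`, Definition 1.2.4; fixed endpoint `x`: `P s e v := e = x`).
[cite: MadrasSlade1993, Theorem 7.3.2 (b), (c) (the restricted families: bridges, Definition 1.2.4; fixed endpoint)] -/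
def MemP (n : ℕ) (ω : ℕ → Site (d + 2)) : Prop := ∀ i, 1 ≤ i → i ≤ n → P (ω 0) (ω n) (ω i)

open Classical in
/-- The family `W_N(P) = {ω ∈ S_N : ∀ 1 ≤ i ≤ N, P (ω 0) (ω N) (ω i)}` (`P` = bridge condition: `W_N` = the
`N`-step bridges, Definition 1.2.4). [cite: MadrasSlade1993, Theorem 7.3.2 (b), (c) (the restricted families)] -/
def famW (n : ℕ) : Finset (ℕ → Site (d + 2)) := (saws (d + 2) n).filter (MemP P n)

open Classical in
/-- Membership in `famW`. [cite: MadrasSlade1993, Theorem 7.3.2 (b), (c) (the restricted families)] -/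
theorem mem_famW {n : ℕ} {ω : ℕ → Site (d + 2)} :
    ω ∈ famW P n ↔ ω ∈ saws (d + 2) n ∧ ∀ i, 1 ≤ i → i ≤ n → P (ω 0) (ω n) (ω i) := by
  unfold famW; rw [Finset.mem_filter]; rfl

/-- A U_W-occurrence: a U-occurrence whose two new sites satisfy `P`. [folklore] -/
private def IsUoccW (n : ℕ) (ω : ℕ → Site (d + 2)) (k : ℕ) (a : Site (d + 2)) : Prop :=
  IsUocc n ω k a ∧ P (ω 0) (ω n) (ω k + a) ∧ P (ω 0) (ω n) (ω (k + 1) + a)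

open Classical in
/-- The U_W-occurrences of `ω`. [folklore] -/
private def uoccW (n : ℕ) (ω : ℕ → Site (d + 2)) : Finset (ℕ × Site (d + 2)) :=
  (Finset.range n ×ˢ units).filter fun p => IsUoccW P n ω p.1 p.2

/-- `I_W(ω)`. [folklore] -/
private def ucountW (n : ℕ) (ω : ℕ → Site (d + 2)) : ℕ := (uoccW P n ω).card

variable {P}

open Classical in
/-- Membership in `uoccW`. [folklore] -/
private theorem mem_uoccW {n : ℕ} {ω : ℕ → Site (d + 2)} {p : ℕ × Site (d + 2)} :
    p ∈ uoccW P n ω ↔ IsUoccW P n ω p.1 p.2 := by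
  unfold uoccW
  rw [Finset.mem_filter, Finset.mem_product, Finset.mem_range]
  exact ⟨fun h => h.2, fun h => ⟨⟨h.1.1, h.1.2.1⟩, h⟩⟩

/-- `uoccW ⊆ uocc`. [folklore] -/
private theorem uoccW_subset (n : ℕ) (ω : ℕ → Site (d + 2)) : uoccW P n ω ⊆ uocc n ω :=
  fun _ hp => mem_uocc.2 (mem_uoccW.1 hp).1

/-- `I_W(ω) ≤ 2(d+2) n`. [folklore] -/
private theorem ucountW_le (n : ℕ) (ω : ℕ → Site (d + 2)) : ucountW P n ω ≤ 2 * (d + 2) * n :=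
  (Finset.card_le_card (uoccW_subset n ω)).trans (ucount_le n ω)

section Closure

variable {n k j : ℕ} {a : Site (d + 2)} {ω : ℕ → Site (d + 2)}

/-- **Swap closure**: the swap at a U_W-occurrence stays in the family. [folklore] -/
private theorem swap_mem_famW (hω : ω ∈ famW P n) (hu : IsUoccW P n ω k a) : swap k a ω ∈ famW P (n + 2) := by
  obtain ⟨hs, hP⟩ := (mem_famW (P := P)).1 hω
  obtain ⟨hu0, hp, hq⟩ := hu
  have hk : k < n := hu0.1
  refine (mem_famW (P := P)).2 ⟨swap_mem_saws hs hu0, fun i hi1 hi2 => ?_⟩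
  rw [swap_of_le (Nat.zero_le k), swap_of_ge (by omega), show n + 2 - 2 = n by omega]
  rcases le_or_gt i k with h | h
  · rw [swap_of_le h]; exact hP i hi1 (by omega)
  rcases lt_trichotomy i (k + 2) with h2 | rfl | h2
  · obtain rfl : i = k + 1 := by omega
    rw [swap_k1]; exact hp
  · rw [swap_k2]; exact hq
  · rw [swap_of_ge (by omega)]; exact hP (i - 2) (by omega) (by omega)

/-- **Contraction closure**: contracting a hairpin stays in the family. [folklore] -/
private theorem contract_mem_famW (hω : ω ∈ famW P (n + 2)) (hj : hairpinAt (n + 2) ω j) :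
    contract j ω ∈ famW P n := by
  obtain ⟨hs, hP⟩ := (mem_famW (P := P)).1 hω
  have hjn : j + 3 ≤ n + 2 := hj.1
  refine (mem_famW (P := P)).2 ⟨contract_mem_saws hs hj, fun i hi1 hi2 => ?_⟩
  rw [contract_of_le (Nat.zero_le j), contract_of_gt (show j < n by omega)]
  rcases le_or_gt i j with h | h
  · rw [contract_of_le h]; exact hP i hi1 (by omega)
  · rw [contract_of_gt h]; exact hP (i + 2) (by omega) (by omega)

/-- The contracted hairpin is a U_W-occurrence of the contraction. [folklore] -/
private theorem isUoccW_contract (hω : ω ∈ famW P (n + 2)) (hj : hairpinAt (n + 2) ω j) :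
    IsUoccW P n (contract j ω) j (ω (j + 1) - ω j) := by
  obtain ⟨hs, hP⟩ := (mem_famW (P := P)).1 hω
  have hjn : j + 3 ≤ n + 2 := hj.1
  refine ⟨isUocc_contract hs hj, ?_, ?_⟩
  · rw [contract_of_le (Nat.zero_le j), contract_of_gt (show j < n by omega), contract_of_le le_rfl,
      add_sub_cancel]
    exact hP (j + 1) (by omega) (by omega)
  · rw [contract_of_le (Nat.zero_le j), contract_of_gt (show j < n by omega),
      contract_of_gt (Nat.lt_succ_self j), show j + 1 + 2 = j + 3 by ring]
    have e2 : ω (j + 3) + (ω (j + 1) - ω j) = ω (j + 2) := by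
      have := hairpin_diag hj
      rw [sub_eq_iff_eq_add] at this
      rw [this]; abel
    rw [e2]; exact hP (j + 2) (by omega) (by omega)

/-- A U_W-occurrence off the step `k` avoiding the two new sites is a U_W-occurrence of the swap. [folklore] -/
private theorem isUoccW_swap {k' : ℕ} {a' : Site (d + 2)} (hu : IsUoccW P n ω k a) (hu' : IsUoccW P n ω k' a')
    (hk' : k' ≠ k) (h1 : ω k' + a' ≠ ω k + a) (h2 : ω k' + a' ≠ ω (k + 1) + a)
    (h3 : ω (k' + 1) + a' ≠ ω k + a) (h4 : ω (k' + 1) + a' ≠ ω (k + 1) + a) :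
    IsUoccW P (n + 2) (swap k a ω) (shiftK k k') a' := by
  have hk : k < n := hu.1.1
  refine ⟨isUocc_swap hu.1 hu'.1 hk' h1 h2 h3 h4, ?_, ?_⟩
  · rw [swap_of_le (Nat.zero_le k), swap_of_ge (by omega), show n + 2 - 2 = n by omega, swap_shiftK hk']
    exact hu'.2.1
  · rw [swap_of_le (Nat.zero_le k), swap_of_ge (by omega), show n + 2 - 2 = n by omega, swap_shiftK_succ k']
    exact hu'.2.2

/-- **`I_W(swap) ≥ I_W(ω) − 10(d+2)`**. [folklore] -/
private theorem ucountW_le_ucountW_swap (hω : ω ∈ saws (d + 2) n) (hu : IsUoccW P n ω k a) :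
    ucountW P n ω ≤ ucountW P (n + 2) (swap k a ω) + 10 * (d + 2) := by
  classical
  set p₀ := ω k + a with hp₀
  set q₀ := ω (k + 1) + a with hq₀
  set bad : ℕ × Site (d + 2) → Prop := fun p =>
    p.1 = k ∨ ω (p.1 + 0) + p.2 = p₀ ∨ ω (p.1 + 0) + p.2 = q₀ ∨ ω (p.1 + 1) + p.2 = p₀ ∨ ω (p.1 + 1) + p.2 = q₀
    with hbad
  have hbad_iff : ∀ p, bad p ↔ (p.1 = k ∨ ω (p.1 + 0) + p.2 = p₀ ∨ ω (p.1 + 0) + p.2 = q₀ ∨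
      ω (p.1 + 1) + p.2 = p₀ ∨ ω (p.1 + 1) + p.2 = q₀) := fun p => Iff.rfl
  unfold ucountW
  have hB : ((uoccW P n ω).filter bad).card ≤ 10 * (d + 2) := by
    refine (Finset.card_le_card (Finset.filter_subset_filter _ (uoccW_subset n ω))).trans ?_
    set A1 := (uocc n ω).filter (fun p => p.1 = k)
    set A2 := (uocc n ω).filter (fun p => ω (p.1 + 0) + p.2 = p₀)
    set A3 := (uocc n ω).filter (fun p => ω (p.1 + 0) + p.2 = q₀)
    set A4 := (uocc n ω).filter (fun p => ω (p.1 + 1) + p.2 = p₀)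
    set A5 := (uocc n ω).filter (fun p => ω (p.1 + 1) + p.2 = q₀)
    have e : (uocc n ω).filter bad = A1 ∪ A2 ∪ A3 ∪ A4 ∪ A5 := by
      ext p; simp only [hbad_iff, Finset.mem_filter, Finset.mem_union, A1, A2, A3, A4, A5]; tauto
    have hk0 : A1.card ≤ 2 * (d + 2) := by
      refine (Finset.card_le_card_of_injOn (fun p => p.2) (fun p hp => ?_) ?_).trans card_units_le
      · exact Finset.mem_coe.2 (mem_uocc.1 (Finset.mem_filter.1 hp).1).2.1
      · intro p hp p' hp' h
        have h1 := (Finset.mem_filter.1 (Finset.mem_coe.1 hp)).2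
        have h2 := (Finset.mem_filter.1 (Finset.mem_coe.1 hp')).2
        exact Prod.ext (by omega) h
    rw [e]
    have c5 := Finset.card_union_le (A1 ∪ A2 ∪ A3 ∪ A4) A5
    have c4 := Finset.card_union_le (A1 ∪ A2 ∪ A3) A4
    have c3 := Finset.card_union_le (A1 ∪ A2) A3
    have c2 := Finset.card_union_le A1 A2
    have b2 : A2.card ≤ 2 * (d + 2) := card_filter_hit_le hω p₀ 0 (by norm_num)
    have b3 : A3.card ≤ 2 * (d + 2) := card_filter_hit_le hω q₀ 0 (by norm_num)
    have b4 : A4.card ≤ 2 * (d + 2) := card_filter_hit_le hω p₀ 1 le_rfl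
    have b5 : A5.card ≤ 2 * (d + 2) := card_filter_hit_le hω q₀ 1 le_rfl
    omega
  have hG : ((uoccW P n ω).filter fun p => ¬ bad p).card ≤ (uoccW P (n + 2) (swap k a ω)).card := by
    refine Finset.card_le_card_of_injOn (fun p => (shiftK k p.1, p.2)) (fun p hp => ?_) ?_
    · obtain ⟨hpU, hpb⟩ := Finset.mem_filter.1 hp
      rw [hbad_iff] at hpb
      simp only [not_or, add_zero] at hpb
      obtain ⟨hk', h1, h2, h3, h4⟩ := hpb
      exact Finset.mem_coe.2 (mem_uoccW.2 (isUoccW_swap hu (mem_uoccW.1 hpU) hk' h1 h2 h3 h4))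
    · intro p hp p' hp' h
      simp only [Prod.mk.injEq] at h
      refine Prod.ext ?_ h.2
      have h1 := h.1
      unfold shiftK at h1
      split_ifs at h1 <;> omega
  rw [← Finset.card_filter_add_card_filter_not (s := uoccW P n ω) bad]
  omega

end Closure

/-! ### Pairs and the chain for the family -/

section PairsW

variable {n : ℕ}

variable (P) in
open Classical in
/-- The U_W-pairs of `W_n`. [folklore] -/
private def uPairsW (n : ℕ) : Finset ((ℕ → Site (d + 2)) × (ℕ × Site (d + 2))) :=
  (famW P n ×ˢ (Finset.range n ×ˢ units)).filter fun p => IsUoccW P n p.1 p.2.1 p.2.2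

variable (P) in
open Classical in
/-- The hairpin pairs of `W_n`. [folklore] -/
private def hPairsW (n : ℕ) : Finset ((ℕ → Site (d + 2)) × ℕ) :=
  (famW P n ×ˢ Finset.range (n + 1)).filter fun p => hairpinAt n p.1 p.2

open Classical in
/-- Membership in `uPairsW`. [folklore] -/
private theorem mem_uPairsW {p : (ℕ → Site (d + 2)) × (ℕ × Site (d + 2))} :
    p ∈ uPairsW P n ↔ p.1 ∈ famW P n ∧ IsUoccW P n p.1 p.2.1 p.2.2 := by
  unfold uPairsW
  rw [Finset.mem_filter, Finset.mem_product, Finset.mem_product, Finset.mem_range]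
  exact ⟨fun h => ⟨h.1.1, h.2⟩, fun h => ⟨⟨h.1, h.2.1.1, h.2.1.2.1⟩, h.2⟩⟩

open Classical in
/-- Membership in `hPairsW`. [folklore] -/
private theorem mem_hPairsW {p : (ℕ → Site (d + 2)) × ℕ} :
    p ∈ hPairsW P n ↔ p.1 ∈ famW P n ∧ hairpinAt n p.1 p.2 := by
  unfold hPairsW
  rw [Finset.mem_filter, Finset.mem_product, Finset.mem_range]
  exact ⟨fun h => ⟨h.1.1, h.2⟩, fun h => ⟨⟨h.1, by have := h.2.1; omega⟩, h.2⟩⟩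

/-- Summing over U_W-pairs. [folklore] -/
private theorem sum_uPairsW (F : (ℕ → Site (d + 2)) → ℝ) :
    ∑ p ∈ uPairsW P n, F p.1 = ∑ ω ∈ famW P n, (ucountW P n ω : ℝ) * F ω := by
  classical
  unfold uPairsW
  rw [Finset.sum_filter, Finset.sum_product]
  refine Finset.sum_congr rfl fun ω _ => ?_
  rw [Finset.sum_ite, Finset.sum_const_zero, add_zero]
  dsimp only
  rw [Finset.sum_const, nsmul_eq_mul]
  rfl

/-- Summing over hairpin pairs of the family. [folklore] -/
private theorem sum_hPairsW (F : (ℕ → Site (d + 2)) → ℝ) :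
    ∑ p ∈ hPairsW P n, F p.1 = ∑ ω ∈ famW P n, (hcount n ω : ℝ) * F ω := by
  classical
  unfold hPairsW
  rw [Finset.sum_filter, Finset.sum_product]
  refine Finset.sum_congr rfl fun ω _ => ?_
  rw [Finset.sum_ite, Finset.sum_const_zero, add_zero]
  dsimp only
  rw [Finset.sum_const, nsmul_eq_mul]
  rfl

/-- **Counting the pairs of the family in two ways.** [cite: MadrasSlade1993, Theorem 7.3.2 (proof),
eq. (7.3.6) (hairpin variant, restricted family)] -/
private theorem sum_uPairsW_eq_sum_hPairsW (F : (ℕ → Site (d + 2)) × (ℕ × Site (d + 2)) → ℝ)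
    (G : (ℕ → Site (d + 2)) × ℕ → ℝ)
    (h : ∀ p ∈ uPairsW P n, F p = G (swap p.2.1 p.2.2 p.1, p.2.1)) :
    ∑ p ∈ uPairsW P n, F p = ∑ q ∈ hPairsW P (n + 2), G q := by
  refine Finset.sum_nbij' (fun p => (swap p.2.1 p.2.2 p.1, p.2.1))
    (fun q => (contract q.2 q.1, (q.2, q.1 (q.2 + 1) - q.1 q.2))) ?_ ?_ ?_ ?_ h
  · intro p hp
    obtain ⟨hω, hu⟩ := mem_uPairsW.1 hp
    exact mem_hPairsW.2 ⟨swap_mem_famW hω hu, hairpinAt_swap hu.1.1⟩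
  · intro q hq
    obtain ⟨hω, hj⟩ := mem_hPairsW.1 hq
    exact mem_uPairsW.2 ⟨contract_mem_famW hω hj, isUoccW_contract hω hj⟩
  · intro p hp
    simp only [contract_swap, swap_k1_sub]
  · intro q hq
    obtain ⟨-, hj⟩ := mem_hPairsW.1 hq
    simp only [swap_contract hj]

/-- **(7.3.6') for the family**: `|W_{N+2}| ≤ #{ω' ∈ W_{N+2} : J = 0} + Σ_{ω ∈ W_N} I_W(ω)/max(J(ω) − 3, 1)`.
[cite: MadrasSlade1993, Theorem 7.3.2 (proof), eq. (7.3.6) (hairpin variant, restricted family)] -/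
private theorem card_famW_add_two_le (N : ℕ) :
    ((famW P (N + 2)).card : ℝ) ≤
      (((famW P (N + 2)).filter fun ω => hcount (N + 2) ω = 0).card : ℝ) +
        ∑ ω ∈ famW P N, (ucountW P N ω : ℝ) / max ((hcount N ω : ℝ) - 3) 1 := by
  classical
  have hsplit : ((famW P (N + 2)).card : ℝ) =
      (((famW P (N + 2)).filter fun ω => hcount (N + 2) ω = 0).card : ℝ) +
        (((famW P (N + 2)).filter fun ω => ¬ hcount (N + 2) ω = 0).card : ℝ) := by
    exact_mod_cast (Finset.card_filter_add_card_filter_not (s := famW P (N + 2))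
      (fun ω => hcount (N + 2) ω = 0)).symm
  have h1 : (((famW P (N + 2)).filter fun ω => ¬ hcount (N + 2) ω = 0).card : ℝ) =
      ∑ q ∈ hPairsW P (N + 2), 1 / (hcount (N + 2) q.1 : ℝ) := by
    rw [sum_hPairsW (n := N + 2) (F := fun ω => 1 / (hcount (N + 2) ω : ℝ)), Finset.card_eq_sum_ones,
      Nat.cast_sum, Finset.sum_filter]
    refine Finset.sum_congr rfl fun ω _ => ?_
    by_cases h : hcount (N + 2) ω = 0
    · rw [if_neg (not_not.2 h), h]; simp
    · rw [if_pos h, mul_one_div_cancel (by exact_mod_cast h)]; simp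
  have h2 : ∑ p ∈ uPairsW P N, 1 / (hcount (N + 2) (swap p.2.1 p.2.2 p.1) : ℝ) =
      ∑ q ∈ hPairsW P (N + 2), 1 / (hcount (N + 2) q.1 : ℝ) :=
    sum_uPairsW_eq_sum_hPairsW _ (fun q => 1 / (hcount (N + 2) q.1 : ℝ)) fun p _ => rfl
  have h3 : ∑ p ∈ uPairsW P N, 1 / (hcount (N + 2) (swap p.2.1 p.2.2 p.1) : ℝ) ≤
      ∑ p ∈ uPairsW P N, 1 / max ((hcount N p.1 : ℝ) - 3) 1 := by
    refine Finset.sum_le_sum fun p hp => ?_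
    obtain ⟨-, hu⟩ := mem_uPairsW.1 hp
    have hJ1 := one_le_hcount_swap (a := p.2.2) (ω := p.1) hu.1.1
    have hJ3 := hcount_le_hcount_swap (n := N) (k := p.2.1) (a := p.2.2) (ω := p.1)
    apply one_div_le_one_div_of_le (by positivity)
    apply max_le
    · have : (hcount N p.1 : ℝ) ≤ hcount (N + 2) (swap p.2.1 p.2.2 p.1) + 3 := by exact_mod_cast hJ3
      linarith
    · exact_mod_cast hJ1
  have h4 : ∑ p ∈ uPairsW P N, 1 / max ((hcount N p.1 : ℝ) - 3) 1 =
      ∑ ω ∈ famW P N, (ucountW P N ω : ℝ) / max ((hcount N ω : ℝ) - 3) 1 := by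
    rw [sum_uPairsW (F := fun ω => 1 / max ((hcount N ω : ℝ) - 3) 1)]
    refine Finset.sum_congr rfl fun ω _ => ?_
    rw [mul_one_div]
  rw [hsplit, h1, ← h2]
  linarith [h4.le]

/-- **(7.3.7') for the family**: `Σ_{ω ∈ W_N} I_W(I_W − 10(d+2))/((J+5)(J+10)) ≤ |W_{N+4}|`.
[cite: MadrasSlade1993, Theorem 7.3.2 (proof), eq. (7.3.7) (hairpin variant, restricted family)] -/
private theorem sum_le_card_famW_add_four (N : ℕ) :
    ∑ ω ∈ famW P N, (ucountW P N ω : ℝ) * ((ucountW P N ω : ℝ) - 10 * (d + 2)) /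
        (((hcount N ω : ℝ) + 5) * ((hcount N ω : ℝ) + 10)) ≤ ((famW P (N + 4)).card : ℝ) := by
  classical
  have hA : ∑ ω' ∈ famW P (N + 2), (ucountW P (N + 2) ω' : ℝ) / ((hcount (N + 2) ω' : ℝ) + 5) ≤
      (famW P (N + 4)).card := by
    have e1 : ∑ ω' ∈ famW P (N + 2), (ucountW P (N + 2) ω' : ℝ) / ((hcount (N + 2) ω' : ℝ) + 5) =
        ∑ p ∈ uPairsW P (N + 2), 1 / ((hcount (N + 2) p.1 : ℝ) + 5) := by
      rw [sum_uPairsW (F := fun ω => 1 / ((hcount (N + 2) ω : ℝ) + 5))]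
      refine Finset.sum_congr rfl fun ω _ => ?_
      rw [mul_one_div]
    have e2 : ∑ p ∈ uPairsW P (N + 2), 1 / ((hcount (N + 2) p.1 : ℝ) + 5) ≤
        ∑ p ∈ uPairsW P (N + 2), 1 / (hcount (N + 2 + 2) (swap p.2.1 p.2.2 p.1) : ℝ) := by
      refine Finset.sum_le_sum fun p hp => ?_
      obtain ⟨-, hu⟩ := mem_uPairsW.1 hp
      have hJ1 := one_le_hcount_swap (a := p.2.2) (ω := p.1) hu.1.1
      have hJ5 := hcount_swap_le (a := p.2.2) (ω := p.1) hu.1.1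
      have hpos : (0 : ℝ) < hcount (N + 2 + 2) (swap p.2.1 p.2.2 p.1) := by exact_mod_cast hJ1
      apply one_div_le_one_div_of_le hpos
      exact_mod_cast hJ5
    have e3 : ∑ p ∈ uPairsW P (N + 2), 1 / (hcount (N + 2 + 2) (swap p.2.1 p.2.2 p.1) : ℝ) =
        ∑ q ∈ hPairsW P (N + 2 + 2), 1 / (hcount (N + 2 + 2) q.1 : ℝ) :=
      sum_uPairsW_eq_sum_hPairsW _ (fun q => 1 / (hcount (N + 2 + 2) q.1 : ℝ)) fun p _ => rfl
    have e4 : ∑ q ∈ hPairsW P (N + 2 + 2), 1 / (hcount (N + 2 + 2) q.1 : ℝ) ≤ (famW P (N + 4)).card := by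
      rw [sum_hPairsW (n := N + 2 + 2) (F := fun ω => 1 / (hcount (N + 2 + 2) ω : ℝ)),
        show N + 4 = N + 2 + 2 by ring, Finset.card_eq_sum_ones, Nat.cast_sum]
      refine Finset.sum_le_sum fun ω _ => ?_
      by_cases h : hcount (N + 2 + 2) ω = 0
      · rw [h]; simp
      · rw [mul_one_div_cancel (by exact_mod_cast h)]; simp
    rw [e1]; exact e2.trans (e3.le.trans e4)
  refine le_trans ?_ hA
  set g : (ℕ → Site (d + 2)) → ℝ := fun ω' =>
    (ucountW P (N + 2) ω' : ℝ) / (((hcount (N + 2) ω' : ℝ) + 5) * (hcount (N + 2) ω' : ℝ)) with hg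
  have hB : ∑ ω' ∈ famW P (N + 2), (hcount (N + 2) ω' : ℝ) * g ω' ≤
      ∑ ω' ∈ famW P (N + 2), (ucountW P (N + 2) ω' : ℝ) / ((hcount (N + 2) ω' : ℝ) + 5) := by
    refine Finset.sum_le_sum fun ω' _ => ?_
    by_cases h : hcount (N + 2) ω' = 0
    · rw [h]; simp only [Nat.cast_zero, zero_mul, zero_add]; positivity
    · have hpos : (0 : ℝ) < hcount (N + 2) ω' := by exact_mod_cast Nat.pos_of_ne_zero h
      rw [hg]; simp only
      rw [show (hcount (N + 2) ω' : ℝ) * ((ucountW P (N + 2) ω' : ℝ) /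
          (((hcount (N + 2) ω' : ℝ) + 5) * (hcount (N + 2) ω' : ℝ))) =
          (ucountW P (N + 2) ω' : ℝ) / ((hcount (N + 2) ω' : ℝ) + 5) by field_simp]
  refine le_trans ?_ hB
  rw [← sum_hPairsW (n := N + 2) (F := g)]
  rw [← sum_uPairsW_eq_sum_hPairsW (fun p => g (swap p.2.1 p.2.2 p.1)) (fun q => g q.1) fun p _ => rfl]
  rw [show ∑ ω ∈ famW P N, (ucountW P N ω : ℝ) * ((ucountW P N ω : ℝ) - 10 * (d + 2)) /
      (((hcount N ω : ℝ) + 5) * ((hcount N ω : ℝ) + 10)) =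
      ∑ ω ∈ famW P N, (ucountW P N ω : ℝ) * (((ucountW P N ω : ℝ) - 10 * (d + 2)) /
      (((hcount N ω : ℝ) + 5) * ((hcount N ω : ℝ) + 10))) from
    Finset.sum_congr rfl fun ω _ => by rw [mul_div_assoc]]
  rw [← sum_uPairsW (F := fun ω => ((ucountW P N ω : ℝ) - 10 * (d + 2)) /
      (((hcount N ω : ℝ) + 5) * ((hcount N ω : ℝ) + 10)))]
  refine Finset.sum_le_sum fun p hp => ?_
  obtain ⟨hω, hu⟩ := mem_uPairsW.1 hp
  have hωs : p.1 ∈ saws (d + 2) N := ((mem_famW (P := P)).1 hω).1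
  set ω' := swap p.2.1 p.2.2 p.1 with hω'
  have hJ1 : (1 : ℝ) ≤ hcount (N + 2) ω' := by
    exact_mod_cast one_le_hcount_swap (a := p.2.2) (ω := p.1) hu.1.1
  have hJ5 : (hcount (N + 2) ω' : ℝ) ≤ hcount N p.1 + 5 := by
    exact_mod_cast hcount_swap_le (a := p.2.2) (ω := p.1) hu.1.1
  have hI : (ucountW P N p.1 : ℝ) ≤ ucountW P (N + 2) ω' + 10 * (d + 2) := by
    exact_mod_cast ucountW_le_ucountW_swap hωs hu
  have hJ0 : (0 : ℝ) ≤ hcount N p.1 := Nat.cast_nonneg _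
  have hI0 : (0 : ℝ) ≤ ucountW P (N + 2) ω' := Nat.cast_nonneg _
  show ((ucountW P N p.1 : ℝ) - 10 * (d + 2)) / (((hcount N p.1 : ℝ) + 5) * ((hcount N p.1 : ℝ) + 10)) ≤ g ω'
  rw [hg]; simp only
  have hden : ((hcount (N + 2) ω' : ℝ) + 5) * (hcount (N + 2) ω' : ℝ) ≤
      ((hcount N p.1 : ℝ) + 5) * ((hcount N p.1 : ℝ) + 10) := by nlinarith
  have hden0 : 0 < ((hcount (N + 2) ω' : ℝ) + 5) * (hcount (N + 2) ω' : ℝ) := by positivity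
  rcases le_or_gt ((ucountW P N p.1 : ℝ) - 10 * (d + 2)) 0 with hneg | hpos
  · exact (div_nonpos_of_nonpos_of_nonneg hneg (by positivity)).trans (div_nonneg hI0 hden0.le)
  · calc ((ucountW P N p.1 : ℝ) - 10 * (d + 2)) / (((hcount N p.1 : ℝ) + 5) * ((hcount N p.1 : ℝ) + 10))
        ≤ ((ucountW P N p.1 : ℝ) - 10 * (d + 2)) / (((hcount (N + 2) ω' : ℝ) + 5) * (hcount (N + 2) ω' : ℝ)) :=
          div_le_div_of_nonneg_left hpos.le hden0 hden
      _ ≤ (ucountW P (N + 2) ω' : ℝ) / (((hcount (N + 2) ω' : ℝ) + 5) * (hcount (N + 2) ω' : ℝ)) :=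
          div_le_div_of_nonneg_right (by linarith) hden0.le

end PairsW

end Family

/-! ### Kesten's inequality for the family from RELATIVE sparsity hypotheses -/

section FamilyIneq

variable {P : Site (d + 2) → Site (d + 2) → Site (d + 2) → Prop}

/-- The constant of the family version: `X₀ + K_Ξ (A² + c₀A) + 2 K_Z`, `X₀ = 64000 A² Q³ + 64 c₀ A Q²`,
`A = 2(d+2)`, `c₀ = 10(d+2)`. [folklore] -/
def kestenBW (d Q : ℕ) (KΞ KZ : ℝ) : ℝ :=
  64000 * (2 * ((d : ℝ) + 2)) ^ 2 * (Q : ℝ) ^ 3 + 64 * (10 * ((d : ℝ) + 2)) * (2 * ((d : ℝ) + 2)) * (Q : ℝ) ^ 2 +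
    KΞ * ((2 * ((d : ℝ) + 2)) ^ 2 + (10 * ((d : ℝ) + 2)) * (2 * ((d : ℝ) + 2))) + 2 * KZ

/-- **Kesten's (7.3.3) for a swap-closed family from relative sparsity** (lane seat a-idea-2, ROUTES §25.19–25.22):
if for `N ≥ N₀` the walks of `W_N` with at most `⌊N/(4Q)⌋` hairpins number `≤ K_Ξ |W_N|/N³` and the hairpin-free
members of `W_{N+2}` number `≤ K_Z |W_N|/N`, `|W_N| ≤ |W_{N+2}|`, and `K_Ξ ≥ (32Q)³` (so that for `N < 32Q` every
member may be put in the "few hairpins" class), then for every `N ≥ max(N₀, 1)`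
`|W_{N+2}|/|W_N| − B/N ≤ |W_{N+4}|/|W_{N+2}|` with `B = kestenBW d Q K_Ξ K_Z`.
[cite: MadrasSlade1993, Lemma 7.3.1, eq. (7.3.3) and Theorem 7.3.2 (proof) (hairpin variant for a restricted
family, this file)] -/
theorem kesten733W (P : Site (d + 2) → Site (d + 2) → Site (d + 2) → Prop) {Q : ℕ} (hQ : 0 < Q)
    {KΞ KZ : ℝ} (hKΞ : ((32 * Q : ℕ) : ℝ) ^ 3 ≤ KΞ) {N₀ : ℕ}
    (hΞ : ∀ N : ℕ, N₀ ≤ N → (N : ℝ) ^ 3 *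
      ((((famW P N).filter fun ω => hcount N ω ≤ N / (4 * Q)).card : ℝ)) ≤ KΞ * (famW P N).card)
    (hZ : ∀ N : ℕ, N₀ ≤ N → (N : ℝ) *
      ((((famW P (N + 2)).filter fun ω => hcount (N + 2) ω = 0).card : ℝ)) ≤ KZ * (famW P N).card)
    (hmono : ∀ N : ℕ, (famW P N).card ≤ (famW P (N + 2)).card) (hpos : ∀ N : ℕ, 1 ≤ (famW P N).card)
    {N : ℕ} (hN0 : N₀ ≤ N) (hN1nat : 1 ≤ N) :
    ((famW P (N + 2)).card : ℝ) / (famW P N).card - kestenBW d Q KΞ KZ / N ≤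
      ((famW P (N + 4)).card : ℝ) / (famW P (N + 2)).card := by
  classical
  have cpos : ∀ m, (0 : ℝ) < (famW P m).card := fun m => by exact_mod_cast hpos m
  set A : ℝ := 2 * ((d : ℝ) + 2) with hA
  set c : ℝ := 10 * ((d : ℝ) + 2) with hc
  have hd0 : (0 : ℝ) ≤ d := Nat.cast_nonneg d
  have hA0 : 0 < A := by rw [hA]; linarith
  have hc0 : 0 ≤ c := by rw [hc]; linarith
  have hQ0 : (0 : ℝ) < Q := by exact_mod_cast hQ
  have hKΞ0 : 0 ≤ KΞ := le_trans (by positivity) hKΞ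
  have hN0' : (0 : ℝ) < N := by exact_mod_cast hN1nat
  have hN1 : (1 : ℝ) ≤ N := by exact_mod_cast hN1nat
  set w : ℕ → ℝ := fun m => ((famW P m).card : ℝ) with hw
  set φ := w (N + 2) / w N with hφ
  set φ' := w (N + 4) / w (N + 2) with hφ'
  have hwpos : ∀ m, 0 < w m := fun m => by simp only [hw]; exact cpos m
  have hφ1 : 1 ≤ φ := by
    rw [hφ, le_div_iff₀ (hwpos N), one_mul]; simp only [hw]; exact_mod_cast hmono N
  have hφ0 : 0 < φ := by linarith
  have hφ'0 : 0 ≤ φ' := div_nonneg (Nat.cast_nonneg _) (Nat.cast_nonneg _)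
  set X0 : ℝ := 64000 * A ^ 2 * Q ^ 3 + 64 * c * A * Q ^ 2 with hX0
  set K3 : ℝ := X0 + KΞ * (A ^ 2 + c * A) with hK3
  set B := kestenBW d Q KΞ KZ with hB
  have hAc : 0 ≤ A ^ 2 + c * A := add_nonneg (pow_nonneg hA0.le 2) (mul_nonneg hc0 hA0.le)
  have hX0_0 : 0 ≤ X0 := by
    rw [hX0]
    have h1 := mul_nonneg (mul_nonneg (by norm_num : (0 : ℝ) ≤ 64000) (pow_nonneg hA0.le 2)) (pow_nonneg hQ0.le 3)
    have h2 := mul_nonneg (mul_nonneg (mul_nonneg (by norm_num : (0 : ℝ) ≤ 64) hc0) hA0.le) (pow_nonneg hQ0.le 2)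
    linarith
  have hK3_0 : 0 ≤ K3 := by rw [hK3]; have := mul_nonneg hKΞ0 hAc; linarith
  have hBdef : B = K3 + 2 * KZ := by rw [hB, hK3, hX0]; unfold kestenBW; rw [← hA, ← hc]
  -- the quantities
  set x : (ℕ → Site (d + 2)) → ℝ := fun ω => (ucountW P N ω : ℝ) / max ((hcount N ω : ℝ) - 3) 1 with hx
  set yv : (ℕ → Site (d + 2)) → ℝ := fun ω =>
    (ucountW P N ω : ℝ) * ((ucountW P N ω : ℝ) - c) / (((hcount N ω : ℝ) + 5) * ((hcount N ω : ℝ) + 10)) with hyv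
  set T := ∑ ω ∈ famW P N, x ω with hT
  set Z : ℝ := (((famW P (N + 2)).filter fun ω => hcount (N + 2) ω = 0).card : ℝ) with hZ'
  have hx0 : ∀ ω, 0 ≤ x ω := fun ω => by
    rw [hx]; exact div_nonneg (Nat.cast_nonneg _) (le_trans zero_le_one (le_max_right _ _))
  have hT0 : 0 ≤ T := Finset.sum_nonneg fun ω _ => hx0 ω
  have hK1 : w (N + 2) ≤ Z + T := card_famW_add_two_le (P := P) N
  have hK2 : ∑ ω ∈ famW P N, yv ω ≤ w (N + 4) := by
    have := sum_le_card_famW_add_four (P := P) N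
    rw [hyv, hc]; exact this
  have hS : T ^ 2 ≤ w N * ∑ ω ∈ famW P N, x ω ^ 2 := by
    rw [hT]; exact sq_sum_le_card_mul_sum_sq
  -- Ξ: pointwise (as in the walk case); for `N < 32Q` every member is treated as "near"
  have hxi : ∀ ω ∈ famW P N, x ω ^ 2 - yv ω ≤
      if (hcount N ω ≤ N / (4 * Q) ∨ N < 32 * Q) then (A * N) ^ 2 + c * (A * N) else X0 / N := by
    intro ω _
    simp only [hx, hyv]
    have hI0 : (0 : ℝ) ≤ ucountW P N ω := Nat.cast_nonneg _
    have hIA : (ucountW P N ω : ℝ) ≤ A * N := by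
      have := ucountW_le (P := P) N ω; rw [hA]; exact_mod_cast this
    have hJ0 : (0 : ℝ) ≤ hcount N ω := Nat.cast_nonneg _
    have hm1 : (1 : ℝ) ≤ max ((hcount N ω : ℝ) - 3) 1 := le_max_right _ _
    split_ifs with hnear
    · exact xi_near hm1 hI0 hIA hc0 hJ0
    · rw [not_or, not_le, not_lt] at hnear
      obtain ⟨hnear, hN⟩ := hnear
      have hNQ : 32 * (Q : ℝ) ≤ N := by exact_mod_cast hN
      have hJ : (N : ℝ) / (4 * Q) ≤ hcount N ω := by
        have h1 := div_le_natDiv_add_one' N (Q := 4 * Q) (by omega)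
        have h2 : ((N / (4 * Q) : ℕ) : ℝ) + 1 ≤ hcount N ω := by exact_mod_cast hnear
        push_cast at h1
        linarith
      have h8 : (8 : ℝ) ≤ (N : ℝ) / (4 * Q) := by rw [le_div_iff₀ (by positivity)]; linarith
      have hm : max ((hcount N ω : ℝ) - 3) 1 = (hcount N ω : ℝ) - 3 := max_eq_left (by linarith)
      rw [hm]
      have hlam : (1 / (8 * (Q : ℝ))) * N ≤ (hcount N ω : ℝ) - 3 := by
        have e : (N : ℝ) / (4 * Q) = 2 * ((1 / (8 * (Q : ℝ))) * N) := by field_simp; ring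
        have h3 : (3 : ℝ) ≤ (1 / (8 * (Q : ℝ))) * N := by linarith
        linarith
      have h := xi_far (I := (ucountW P N ω : ℝ)) (m := (hcount N ω : ℝ) - 3) (c := c) (A := A)
        (lam := 1 / (8 * (Q : ℝ))) (Nr := (N : ℝ)) (by linarith) (by positivity) hN0' hlam hI0 hIA hc0
      have e1 : ((hcount N ω : ℝ) - 3 + 8) * ((hcount N ω : ℝ) - 3 + 13) =
          ((hcount N ω : ℝ) + 5) * ((hcount N ω : ℝ) + 10) := by ring
      rw [e1] at h
      have e2 : (125 * A ^ 2 / (1 / (8 * (Q : ℝ))) ^ 3 + c * A / (1 / (8 * (Q : ℝ))) ^ 2) = X0 := by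
        rw [hX0]; field_simp; ring
      rw [e2] at h
      exact h
  -- Ξ: summed with the relative hypothesis (for `N < 32Q`: everything is near and `N³ ≤ (32Q)³ ≤ K_Ξ`)
  have hnear : ((((famW P N).filter fun ω => hcount N ω ≤ N / (4 * Q) ∨ N < 32 * Q).card : ℝ)) * (N : ℝ) ^ 3 ≤
      KΞ * w N := by
    by_cases h32 : N < 32 * Q
    · have hf : ((famW P N).filter fun ω => hcount N ω ≤ N / (4 * Q) ∨ N < 32 * Q) = famW P N :=
        Finset.filter_true_of_mem fun ω _ => Or.inr h32
      rw [hf]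
      have hN3 : (N : ℝ) ^ 3 ≤ KΞ := by
        refine le_trans ?_ hKΞ
        exact pow_le_pow_left₀ (Nat.cast_nonneg _) (by exact_mod_cast h32.le) 3
      calc w N * (N : ℝ) ^ 3 ≤ w N * KΞ := mul_le_mul_of_nonneg_left hN3 (hwpos N).le
        _ = KΞ * w N := mul_comm _ _
    · have hf : ((famW P N).filter fun ω => hcount N ω ≤ N / (4 * Q) ∨ N < 32 * Q) =
          ((famW P N).filter fun ω => hcount N ω ≤ N / (4 * Q)) :=
        Finset.filter_congr fun ω _ => by simp only [h32, or_false]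
      rw [hf]
      have := hΞ N hN0; rw [mul_comm] at this; exact this
  have hANc : 0 ≤ (A * N) ^ 2 + c * (A * N) :=
    add_nonneg (sq_nonneg _) (mul_nonneg hc0 (mul_nonneg hA0.le hN0'.le))
  have hN2 : (N : ℝ) ≤ (N : ℝ) ^ 2 := le_self_pow₀ hN1 (by norm_num)
  have hΞs : ∑ ω ∈ famW P N, (x ω ^ 2 - yv ω) ≤ w N * (K3 / N) := by
    calc ∑ ω ∈ famW P N, (x ω ^ 2 - yv ω)
        ≤ ∑ ω ∈ famW P N,
            (if (hcount N ω ≤ N / (4 * Q) ∨ N < 32 * Q) then (A * N) ^ 2 + c * (A * N) else X0 / N) :=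
          Finset.sum_le_sum hxi
      _ = (((famW P N).filter fun ω => hcount N ω ≤ N / (4 * Q) ∨ N < 32 * Q).card : ℝ) *
            ((A * N) ^ 2 + c * (A * N)) +
          (((famW P N).filter fun ω => ¬ (hcount N ω ≤ N / (4 * Q) ∨ N < 32 * Q)).card : ℝ) * (X0 / N) := by
          rw [Finset.sum_ite, Finset.sum_const, Finset.sum_const, nsmul_eq_mul, nsmul_eq_mul]
      _ ≤ (((famW P N).filter fun ω => hcount N ω ≤ N / (4 * Q) ∨ N < 32 * Q).card : ℝ) *
            ((A ^ 2 + c * A) * N ^ 2) + w N * (X0 / N) := by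
          refine add_le_add (mul_le_mul_of_nonneg_left ?_ (Nat.cast_nonneg _))
            (mul_le_mul_of_nonneg_right ?_ (div_nonneg hX0_0 hN0'.le))
          · have := mul_le_mul_of_nonneg_left hN2 (mul_nonneg hc0 hA0.le)
            calc (A * N) ^ 2 + c * (A * N) = A ^ 2 * N ^ 2 + c * A * N := by ring
              _ ≤ A ^ 2 * N ^ 2 + c * A * N ^ 2 := by linarith
              _ = (A ^ 2 + c * A) * N ^ 2 := by ring
          · simp only [hw]; exact_mod_cast Finset.card_filter_le _ _
      _ ≤ KΞ * w N * (A ^ 2 + c * A) / N + w N * (X0 / N) := by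
          refine add_le_add ?_ le_rfl
          rw [le_div_iff₀ hN0']
          have := mul_le_mul_of_nonneg_right hnear hAc
          calc (((famW P N).filter fun ω => hcount N ω ≤ N / (4 * Q) ∨ N < 32 * Q).card : ℝ) *
                ((A ^ 2 + c * A) * N ^ 2) * N
              = (((famW P N).filter fun ω => hcount N ω ≤ N / (4 * Q) ∨ N < 32 * Q).card : ℝ) * (N : ℝ) ^ 3 *
                (A ^ 2 + c * A) := by
                ring
            _ ≤ KΞ * w N * (A ^ 2 + c * A) := this
      _ = w N * (K3 / N) := by rw [hK3]; ring
  have hsumsq : ∑ ω ∈ famW P N, x ω ^ 2 ≤ w (N + 4) + w N * (K3 / N) := by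
    have : ∑ ω ∈ famW P N, x ω ^ 2 = ∑ ω ∈ famW P N, yv ω + ∑ ω ∈ famW P N, (x ω ^ 2 - yv ω) := by
      rw [← Finset.sum_add_distrib]; exact Finset.sum_congr rfl fun ω _ => by ring
    rw [this]; linarith [hK2, hΞs]
  have hZle : Z ≤ KZ / N * w N := by
    have := hZ N hN0
    rw [div_mul_eq_mul_div, le_div_iff₀ hN0', mul_comm]; exact this
  -- final algebra: divide by φ ≥ 1
  set z := Z / w N with hz
  set t := T / w N with ht
  have hZ0 : 0 ≤ Z := by rw [hZ']; exact Nat.cast_nonneg _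
  have hz0 : 0 ≤ z := div_nonneg hZ0 (hwpos N).le
  have hzle : z ≤ KZ / N := by rw [hz, div_le_iff₀ (hwpos N)]; exact hZle
  have ht0 : 0 ≤ t := div_nonneg hT0 (hwpos N).le
  have hφzt : φ ≤ z + t := by
    rw [hφ, hz, ht, ← add_div, div_le_div_iff_of_pos_right (hwpos N)]; exact hK1
  have hφφ' : φ * φ' = w (N + 4) / w N := by
    rw [hφ, hφ', div_mul_div_comm, mul_comm (w (N + 2)), mul_div_mul_right _ _ (hwpos (N + 2)).ne']
  have ht2 : t ^ 2 ≤ φ * φ' + K3 / N := by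
    have h1 : t ^ 2 = T ^ 2 / (w N) ^ 2 := by rw [ht, div_pow]
    have h2 : T ^ 2 / (w N) ^ 2 ≤ (w N * (w (N + 4) + w N * (K3 / N))) / (w N) ^ 2 :=
      div_le_div_of_nonneg_right (hS.trans (mul_le_mul_of_nonneg_left hsumsq (hwpos N).le)) (sq_nonneg _)
    have h3 : (w N * (w (N + 4) + w N * (K3 / N))) / (w N) ^ 2 = w (N + 4) / w N + K3 / N := by
      have := (hwpos N).ne'
      have := hN0'.ne'
      field_simp
    rw [hφφ', h1]
    linarith [h2, h3.le, h3.ge]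
  have hBz : 2 * z + K3 / N ≤ B / N := by
    have eB : B / N = K3 / N + 2 * (KZ / N) := by rw [hBdef]; ring
    rw [eB]; linarith [hzle]
  rcases le_or_gt φ z with hle | hgt
  · -- `φ ≤ z ≤ K_Z/N ≤ B/N` and `φ' ≥ 0`
    have : φ ≤ B / N := by
      have h2 : K3 / N ≥ 0 := div_nonneg hK3_0 hN0'.le
      linarith [hzle]
    linarith
  · have h1 : (φ - z) ^ 2 ≤ t ^ 2 := pow_le_pow_left₀ (by linarith) (by linarith) 2
    have e : (φ - z) ^ 2 = φ ^ 2 - 2 * (φ * z) + z ^ 2 := by ring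
    -- `φ (φ − 2z − φ') ≤ K3/N`
    have hh : φ ^ 2 - 2 * (φ * z) + z ^ 2 ≤ φ * φ' + K3 / N := by rw [← e]; exact h1.trans ht2
    have h2 : φ * (φ - 2 * z - φ') ≤ K3 / N := by
      have e2 : φ * (φ - 2 * z - φ') = φ ^ 2 - 2 * (φ * z) - φ * φ' := by ring
      rw [e2]; linarith [hh, sq_nonneg z]
    have h3 : φ - 2 * z - φ' ≤ K3 / N := by
      rcases le_or_gt 0 (φ - 2 * z - φ') with hnn | hneg
      · have := mul_le_mul_of_nonneg_right hφ1 hnn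
        linarith
      · have : 0 ≤ K3 / N := div_nonneg hK3_0 hN0'.le
        linarith
    linarith

end FamilyIneq

end KestenHairpin

end Literature.Probability.RandomPlanarGeometry.SAW.Zd
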